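import Literature.Probability.RandomPlanarGeometry.HexSAWPolygonStepSix
import HarnessLib

/-!
# The step `2` for honeycomb polygon numbers on the MAIN classes: `#{X ∪ Y1a} ≤ q_{N+2}(ℍ)` (towards `q_N(ℍ) ≤ q_{N+2}(ℍ)`, even `N ≥ 12`)

Topic `Literature/Probability/RandomPlanarGeometry` (lane «pcv-sawmu», a-p4 g16 seed + a-p4 g18 assembly; sequel of
`HexSAWPolygonStepSix.lean` — `PolygonConcat.canonEnd n` = the canonically rooted `(n+1)`-gons of the honeycomb (brick-wall) lattice,
`#canonEnd n = q_{n+1}(ℍ)` (`HexSAWPolygonSupermult`), the top-corner machinery `exists_top_corner`, `topAt_unique`, `caseA_fwd/bwd`,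
`tpath`, `rd`, `w6A`, and the `+6` injection `stepSix`).

Madras–Slade prove `q_N ≤ q_{N+2}` on `ℤ^d` by a unit-square surgery at the lexicographically largest vertex [MadrasSlade1993, §3.2,
Theorem 3.2.3, (3.2.3) p. 64, proof p. 65].  On the honeycomb lattice that statement is FALSE at `N = 6, 10` (tree:
`HexSAWPolygonCensus.not_hexPolygonNumber_le_add_two`) and OPEN for `N ≥ 12` (true on data to `N = 40`); every even step `≥ 4` is a
tree theorem (`HexSAWPolygonMonotone`, `HexSAWPolygonStepSix`).  THIS FILE proves the step `2` on the part of `canonEnd n` where a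
single-hexagon surgery AT THE TOP CORNER works, with its decoding, and isolates the residue as a named class:

* `spliceAdd K L ω π j` / `SpliceAddOK` / `spliceAdd_mem_canonEnd` — the `K`-general window surgery (STEP-SIX's `splice6` with the
  length gain `K` as a parameter) and its admissibility certificate; `eq_of_spliceAdd_eq` reads the source off the image.
* Class **X** (the top run continues left of the top-right brick: `(xm−3,H) ∈ ω`): flip over the brick above the window
  `(xm−3,H)(xm−2,H)(xm−1,H)` — `spliceOK_X`, `spliceX_mem_canonEnd`, `stepTwo_exists_X` / `stepTwo_data_X`, image corner
  `topAt_spliceX`, signatures, `spliceX_decode`.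
* Class **Y1a** (below the corner the walk steps down, right, down): flip across the cell `cE` right of the corner — `caseY_free`,
  `spliceOK_Y`, `spliceY_mem_canonEnd`, `stepTwo_exists_Y_fwd/bwd` / `stepTwo_data_Y_fwd/bwd`, `topAt_spliceY`, `spliceY_decode`;
  and `spliceX_ne_spliceY` (X-images and Y-images never coincide).
* `stepTwo_classify` / `IsStepTwoMain` / `IsStepTwoResidue` / `isStepTwoMain_or_isStepTwoResidue`: at its top corner every canonical
  rooted polygon (`n ≥ 5`) is of class X, Y1a, or in the RESIDUE (`(xm−3,H) ∉ ω` and below the corner a step LEFT (Y2) or two steps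
  RIGHT (Y1b)).
* ★ **`card_filter_isStepTwoMain_le : 5 ≤ n → #{ω ∈ canonEnd n | IsStepTwoMain n ω} ≤ #canonEnd (n+2)`** — the surgeries are an
  INJECTION on the main class (decoding is datum-free: `eq_of_stepTwoMain_image_eq`), and the complement form
  `card_canonEnd_sub_card_filter_residue_le : #canonEnd n − #{residue} ≤ #canonEnd (n+2)`.

NOT claimed: `q_N(ℍ) ≤ q_{N+2}(ℍ)` itself.  The residue is non-empty for every `n ≥ 13` (numerically 0, 4, 4, 21, 37, 136, 304, 999
of the 2, 12, 18, 65, 138, 432, 1074, 3231 polygons for `n = 11, 13, …, 25` — about 30 %; the mirrored move at the BOTTOM corner serves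
two thirds of it, lane scripts `HOME/pub-sawmu-a-p4/g16/two/py/`, `g17/two/py/`, `g18/two/py/`) and contains the flip-free «Y»
polygons, which admit no single-hexagon `+2` surgery anywhere; closing it needs two-cell moves with their own decoding (door notes
`HOME/pub-sawmu-a-p4/g16/DOOR-HEX-POLYGON-STEP-TWO.md`, `g17/two/…addendum-g17.md`, `g18/two/…addendum-g18.md`).
Label (lane): LANE LEMMA / infrastructure for an open combinatorial item; no literature claim beyond the transplanted `ℤ^d` method.
-/

noncomputable section

open Finset Function Literature.Probability.LatticeModels Literature.Probability.Percolation SimpleGraph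

namespace Literature.Probability.RandomPlanarGeometry.SAW

namespace HexBW

namespace PolygonConcat

variable {n : ℕ} {ω : ℕ → Site 2}

/-- Two sites of `ℤ²` are equal iff both coordinates agree. [folklore; lane plumbing] [cite: MadrasSlade1993, §1.1] -/
private theorem s2_site_eq_iff {x y : Site 2} : x = y ↔ x 0 = y 0 ∧ x 1 = y 1 := by
  constructor
  · rintro rfl; exact ⟨rfl, rfl⟩
  · rintro ⟨h0, h1⟩; funext i; fin_cases i <;> assumption

/-- `pt a b` is lexicographically `≥ 0` when `a > 0`, or `a = 0 ≤ b`. [cite: MadrasSlade1993, §3.2 (proof of Theorem 3.2.3: `Q[N]`)] -/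
private theorem s2_lexNonneg_pt {a b : ℤ} (h : 0 < a ∨ (a = 0 ∧ 0 ≤ b)) : LexNonneg (pt a b) := by
  unfold LexNonneg; simpa using h


section Splice2

variable {K L j : ℕ} {π : ℕ → Site 2}

/-- **Splice**: `ω` up to time `j`, then the path `π(0 .. L+K)` (with `π 0 = ω j`, `π (L+K) = ω (j+L)`), then `ω` from time `j+L` on —
a walk of length `n + K`. [cite: MadrasSlade1993, §3.2 (proof of Theorem 3.2.3: local surgery on a polygon)] -/
def spliceAdd (K L : ℕ) (ω π : ℕ → Site 2) (j : ℕ) (i : ℕ) : Site 2 :=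
  if i ≤ j then ω i else if i ≤ j + L + K then π (i - j) else ω (i - K)

/-- Before the window. [cite: MadrasSlade1993, §3.2 (proof of Theorem 3.2.3)] -/
theorem spliceAdd_of_le {i : ℕ} (h : i ≤ j) : spliceAdd K L ω π j i = ω i := if_pos h

/-- On the new path (both ends included, given `π 0 = ω j`). [cite: MadrasSlade1993, §3.2 (proof of Theorem 3.2.3)] -/
theorem spliceAdd_mid (hπ0 : π 0 = ω j) {s : ℕ} (hs : s ≤ L + K) : spliceAdd K L ω π j (j + s) = π s := by
  unfold spliceAdd
  rcases Nat.eq_zero_or_pos s with rfl | hs0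
  · rw [if_pos (by omega), hπ0, add_zero]
  · rw [if_neg (by omega), if_pos (by omega), Nat.add_sub_cancel_left]

/-- After the window (its end included, given `π (L+K) = ω (j+L)`). [cite: MadrasSlade1993, §3.2 (proof of Theorem 3.2.3)] -/
theorem spliceAdd_of_ge (hπL : π (L + K) = ω (j + L)) {i : ℕ} (h : j + L + K ≤ i) : spliceAdd K L ω π j i = ω (i - K) := by
  unfold spliceAdd
  by_cases hij : i ≤ j
  · rw [if_pos hij, show i - K = i by omega]
  rw [if_neg hij]
  rcases eq_or_lt_of_le h with rfl | hlt
  · rw [if_pos le_rfl, show j + L + K - j = L + K by omega, hπL, show j + L + K - K = j + L by omega]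
  · rw [if_neg (by omega)]

/-- Hypotheses of the top surgery on the new path `π`: a self-avoiding brick-wall path of length `L + K` between `ω j` and `ω (j+L)`
whose interior avoids every site of `ω` outside the window, all of whose sites are lexicographically `≥ 0`.
[cite: MadrasSlade1993, §3.2 (proof of Theorem 3.2.3)] -/
structure SpliceAddOK (n K L : ℕ) (ω : ℕ → Site 2) (j : ℕ) (π : ℕ → Site 2) : Prop where
  one_le : 1 ≤ L
  wnd : j + L ≤ n
  start : π 0 = ω j
  finish : π (L + K) = ω (j + L)
  adj : ∀ s, s < L + K → brickWallGraph.Adj (π s) (π (s + 1))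
  inj : Set.InjOn π {s | s ≤ L + K}
  fresh : ∀ s, 0 < s → s < L + K → ∀ i, i ≤ n → (i < j ∨ j + L < i) → π s ≠ ω i
  lex : ∀ s, s ≤ L + K → LexNonneg (π s)

/-- **The spliced walk is a rooted `(n+K+1)`-gon**: `spliceAdd K L ω π j ∈ E_{n+K}(e₀)` for `ω ∈ E_n(e₀)` and a path satisfying `SpliceAddOK`.
[cite: MadrasSlade1993, §3.2 (proof of Theorem 3.2.3: "the result is a self-avoiding polygon")] -/
theorem spliceAdd_mem (hω : ω ∈ endAt n (Pi.single 0 1 : Site 2)) (hP : SpliceAddOK n K L ω j π) :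
    spliceAdd K L ω π j ∈ endAt (n + K) (Pi.single 0 1 : Site 2) := by
  obtain ⟨⟨h0, hfr, hbw, hinj⟩, hn'⟩ := mem_endAt_iff.1 hω
  have hL := hP.one_le
  have hwnd := hP.wnd
  have hge : ∀ i, j + L + K ≤ i → spliceAdd K L ω π j i = ω (i - K) := fun i hi => spliceAdd_of_ge hP.finish hi
  rw [mem_endAt_iff]
  refine ⟨⟨by rw [spliceAdd_of_le (Nat.zero_le _), h0], ?_, ?_, ?_⟩, ?_⟩
  · -- frozen after `n + K`
    intro i hi
    rw [hge i (by omega), hge (n + K) (by omega), hfr _ (by omega), show n + K - K = n by omega]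
  · -- steps
    intro i hi
    rcases Nat.lt_or_ge i j with h1 | h1
    · rw [spliceAdd_of_le h1.le, spliceAdd_of_le (by omega)]; exact hbw i (by omega)
    rcases Nat.lt_or_ge i (j + L + K) with h2 | h2
    · obtain ⟨s, rfl⟩ : ∃ s, i = j + s := ⟨i - j, by omega⟩
      rw [spliceAdd_mid hP.start (by omega), show j + s + 1 = j + (s + 1) by omega, spliceAdd_mid hP.start (by omega)]
      exact hP.adj s (by omega)
    · rw [hge i h2, hge (i + 1) (by omega), show i + 1 - K = i - K + 1 by omega]
      exact hbw _ (by omega)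
  · -- injective on `[0, n+K]`
    have hout : ∀ i, i ≤ n + K → (i ≤ j ∨ j + L + K ≤ i) →
        ∃ a, a ≤ n ∧ spliceAdd K L ω π j i = ω a ∧ (i ≤ j → a = i) ∧ (j + L + K ≤ i → a = i - K) := by
      intro i hi hio
      rcases hio with h1 | h1
      · exact ⟨i, by omega, spliceAdd_of_le h1, fun _ => rfl, fun h => by omega⟩
      · exact ⟨i - K, by omega, hge i h1, fun h => by omega, fun _ => rfl⟩
    -- a site of `ω` equal to an interior site of `π` is impossible
    have hcross : ∀ a s, a ≤ n → (a ≤ j ∨ j + L ≤ a) → 0 < s → s < L + K → ω a ≠ π s := by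
      intro a s ha hajL hs1 hs2 heq
      rcases hajL with h1 | h1
      · rcases eq_or_lt_of_le h1 with rfl | hlt
        · rw [← hP.start] at heq
          have := hP.inj (show 0 ∈ {s | s ≤ L + K} by simp) (show s ∈ {s | s ≤ L + K} by simp; omega) heq; omega
        · exact hP.fresh s hs1 hs2 a ha (Or.inl hlt) heq.symm
      · rcases eq_or_lt_of_le h1 with h2 | hlt
        · rw [← h2, ← hP.finish] at heq
          have := hP.inj (show L + K ∈ {s | s ≤ L + K} by simp) (show s ∈ {s | s ≤ L + K} by simp; omega) heq; omega
        · exact hP.fresh s hs1 hs2 a ha (Or.inr hlt) heq.symm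
    suffices key : ∀ i i', i < i' → i' ≤ n + K → spliceAdd K L ω π j i ≠ spliceAdd K L ω π j i' by
      intro i hi i' hi' h
      simp only [Set.mem_setOf_eq] at hi hi'
      by_contra hne
      rcases Nat.lt_or_gt_of_ne hne with hlt | hlt
      · exact key i i' hlt hi' h
      · exact key i' i hlt hi h.symm
    intro i i' hlt hi' h
    by_cases hwi : j < i ∧ i < j + L + K <;> by_cases hwi' : j < i' ∧ i' < j + L + K
    · obtain ⟨s, rfl⟩ : ∃ s, i = j + s := ⟨i - j, by omega⟩
      obtain ⟨s', rfl⟩ : ∃ s', i' = j + s' := ⟨i' - j, by omega⟩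
      rw [spliceAdd_mid hP.start (by omega), spliceAdd_mid hP.start (by omega)] at h
      have := hP.inj (show s ∈ {s | s ≤ L + K} by simp; omega) (show s' ∈ {s | s ≤ L + K} by simp; omega) h
      omega
    · obtain ⟨s, rfl⟩ : ∃ s, i = j + s := ⟨i - j, by omega⟩
      obtain ⟨a, ha, hia, ha1, ha2⟩ := hout i' hi' (by omega)
      rw [spliceAdd_mid hP.start (by omega), hia] at h
      refine hcross a s ha ?_ (by omega) (by omega) h.symm
      rcases le_or_gt i' j with h1 | h1
      · left; rw [ha1 h1]; exact h1
      · right; rw [ha2 (by omega)]; omega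
    · obtain ⟨s', rfl⟩ : ∃ s', i' = j + s' := ⟨i' - j, by omega⟩
      obtain ⟨a, ha, hia, ha1, ha2⟩ := hout i (by omega) (by omega)
      rw [spliceAdd_mid hP.start (by omega), hia] at h
      refine hcross a s' ha ?_ (by omega) (by omega) h
      rcases le_or_gt i j with h1 | h1
      · left; rw [ha1 h1]; exact h1
      · right; rw [ha2 (by omega)]; omega
    · obtain ⟨a, ha, hia, ha1, ha2⟩ := hout i (by omega) (by omega)
      obtain ⟨a', ha', hia', ha1', ha2'⟩ := hout i' hi' (by omega)
      rw [hia, hia'] at h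
      have haa := hinj (show a ∈ {i | i ≤ n} by simpa using ha) (show a' ∈ {i | i ≤ n} by simpa using ha') h
      have : a < a' := by
        rcases le_or_gt i j with h1 | h1 <;> rcases le_or_gt i' j with h2 | h2
        · rw [ha1 h1, ha1' h2]; exact hlt
        · rw [ha1 h1, ha2' (by omega)]; omega
        · omega
        · rw [ha2 (by omega), ha2' (by omega)]; omega
      omega
  · rw [hge (n + K) (by omega), show n + K - K = n by omega, hn']

/-- **The spliced walk is canonical** when `ω` is and the new path is lexicographically `≥ 0`.
[cite: MadrasSlade1993, §3.2 (proof of Theorem 3.2.3: `Q[N]`)] -/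
theorem spliceAdd_mem_canonEnd (hω : ω ∈ canonEnd n) (hP : SpliceAddOK n K L ω j π) : spliceAdd K L ω π j ∈ canonEnd (n + K) := by
  obtain ⟨hE, hlex⟩ := mem_canonEnd.1 hω
  refine mem_canonEnd.2 ⟨spliceAdd_mem hE hP, fun i hi => ?_⟩
  rcases le_or_gt i j with h1 | h1
  · rw [spliceAdd_of_le h1]; exact hlex i (by have := hP.wnd; omega)
  rcases Nat.lt_or_ge i (j + L + K) with h2 | h2
  · obtain ⟨s, rfl⟩ : ∃ s, i = j + s := ⟨i - j, by omega⟩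
    rw [spliceAdd_mid hP.start (by omega)]; exact hP.lex s (by omega)
  · rw [spliceAdd_of_ge hP.finish h2]; exact hlex _ (by omega)

end Splice2


section StepTwoX

variable {xm H : ℤ} {fwd : Bool} {j L K i₀ : ℕ}

/-- **Surgery hypotheses from tables, general length gain `K`** (the `K`-general form of `splice6OK_of_tables`).
[cite: MadrasSlade1993, §3.2 (proof of Theorem 3.2.3: local surgery)] -/
theorem spliceAddOK_of_tables {off w : ℕ → ℤ × ℤ} (hL : 1 ≤ L) (h0 : off 0 = w 0) (hKL : off (L + K) = w L)
    (hadj : ∀ s, s < L + K → brickWallGraph.Adj (pt (xm + (off s).1) (H + (off s).2)) (pt (xm + (off (s + 1)).1) (H + (off (s + 1)).2)))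
    (hinj : ∀ s s', s ≤ L + K → s' ≤ L + K →
      pt (xm + (off s).1) (H + (off s).2) = pt (xm + (off s').1) (H + (off s').2) → s = s')
    (hfresh : ∀ u, 0 < u → u < L + K → ∀ i, i ≤ n → (i < j ∨ j + L < i) → pt (xm + (off u).1) (H + (off u).2) ≠ ω i)
    (hlex : ∀ u, u ≤ L + K → LexNonneg (pt (xm + (off u).1) (H + (off u).2)))
    (hw : ∀ s, s ≤ L → ω (j + s) = tpath w L xm H fwd s) (hwnd : j + L ≤ n) :
    SpliceAddOK n K L ω j (tpath off (L + K) xm H fwd) := by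
  refine ⟨hL, hwnd, ?_, ?_, fun s hs => tpath_adj hadj hs, tpath_injOn hinj, ?_, ?_⟩
  · have h := hw 0 (Nat.zero_le _); rw [add_zero] at h; rw [h]
    cases fwd
    · rw [tpath_zero_false, tpath_zero_false, hKL]
    · rw [tpath_zero_true, tpath_zero_true, h0]
  · rw [hw L le_rfl]
    cases fwd
    · rw [tpath_last_false, tpath_last_false, h0]
    · rw [tpath_last_true, tpath_last_true, hKL]
  · intro s hs0 hs1 i hi hio
    obtain ⟨hu0, hu1⟩ := rd_pos_lt (fwd := fwd) hs0 hs1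
    exact hfresh _ hu0 hu1 i hi hio
  · intro s hs
    exact hlex _ (rd_le hs)

/-- Case X path of the step-`2` line (the `+2` flip across the brick `[xm−3,xm−1]×[H,H+1]` above the top run): from `(xm−3,H)` up,
right twice, down to `(xm−1,H)` — 4 bonds replacing the 2-window `(xm−3,H)(xm−2,H)(xm−1,H)` (= `w6A`).
[cite: MadrasSlade1993, §3.2 (proof of Theorem 3.2.3: local surgery)] -/
def offX : ℕ → ℤ × ℤ
  | 0 => (-3, 0) | 1 => (-3, 1) | 2 => (-2, 1) | 3 => (-1, 1) | _ => (-1, 0)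

/-- Table X is a brick-wall path (given the top-corner parity `xm + H` odd). [cite: EntingJensen2009, §7.4.2, Fig. 7.10] -/
theorem offX_adj (hpar : (xm + H) % 2 = 1) {s : ℕ} (hs : s < 4) :
    brickWallGraph.Adj (pt (xm + (offX s).1) (H + (offX s).2)) (pt (xm + (offX (s + 1)).1) (H + (offX (s + 1)).2)) := by
  interval_cases s <;> simp only [offX] <;> exact adj_pt_iff.2 (by omega)

/-- Table X is injective on `[0,4]`. [cite: MadrasSlade1993, §3.2] -/
theorem offX_inj {s s' : ℕ} (hs : s ≤ 4) (hs' : s' ≤ 4)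
    (h : pt (xm + (offX s).1) (H + (offX s).2) = pt (xm + (offX s').1) (H + (offX s').2)) : s = s' := by
  interval_cases s <;> interval_cases s' <;> simp only [offX] at h <;>
    first | rfl | (obtain ⟨h1, h2⟩ := pt_inj.1 h; omega)

/-- **Case X surgery is admissible**: for `xm ≥ 3` and the window `(xm−3,H)(xm−2,H)(xm−1,H)` on `ω` (STEP-SIX's case-A geometry), the
`+2` flip over the brick above it satisfies `SpliceAddOK n 2 2`. [cite: MadrasSlade1993, §3.2 (proof of Theorem 3.2.3: local surgery)] -/
theorem spliceOK_X (hpar : (xm + H) % 2 = 1) (hx : 3 ≤ xm) (hH : 0 ≤ H)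
    (hmaxH : ∀ i, i ≤ n → ω i 1 ≤ H) (hmaxX : ∀ i, i ≤ n → ω i 1 = H → ω i 0 ≤ xm)
    (hw : ∀ s, s ≤ 2 → ω (j + s) = tpath w6A 2 xm H fwd s) (hwnd : j + 2 ≤ n) :
    SpliceAddOK n 2 2 ω j (tpath offX 4 xm H fwd) := by
  refine spliceAddOK_of_tables (L := 2) (K := 2) (w := w6A) (by norm_num) (by rfl) (by rfl) (fun s hs => offX_adj hpar hs)
    (fun s s' hs hs' h => offX_inj hs hs' h) (fun u hu0 hu1 i hi _ => ?_) (fun u hu => ?_) hw hwnd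
  · interval_cases u <;> simp only [offX] <;> exact ne_of_high hmaxH hmaxX (by omega) hi
  · interval_cases u <;> simp only [offX] <;> exact s2_lexNonneg_pt (by omega)

/-- **The case-X image is a canonical `(n+3)`-gon.** [cite: MadrasSlade1993, §3.2 (proof of Theorem 3.2.3)] -/
theorem spliceX_mem_canonEnd (hω : ω ∈ canonEnd n) (hpar : (xm + H) % 2 = 1) (hx : 3 ≤ xm) (hH : 0 ≤ H)
    (hmaxH : ∀ i, i ≤ n → ω i 1 ≤ H) (hmaxX : ∀ i, i ≤ n → ω i 1 = H → ω i 0 ≤ xm)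
    (hw : ∀ s, s ≤ 2 → ω (j + s) = tpath w6A 2 xm H fwd s) (hwnd : j + 2 ≤ n) :
    spliceAdd 2 2 ω (tpath offX 4 xm H fwd) j ∈ canonEnd (n + 2) :=
  spliceAdd_mem_canonEnd hω (spliceOK_X hpar hx hH hmaxH hmaxX hw hwnd)

/-- Window table of case Y (offsets from the corner): `(xm,H), (xm,H−1), (xm+1,H−1)` — the corner, the step down, the step right.
[cite: MadrasSlade1993, §3.2] -/
def w2Y : ℕ → ℤ × ℤ | 0 => (0, 0) | 1 => (0, -1) | _ => (1, -1)

/-- Case Y path of the step-`2` line (the `+2` flip across the brick `cE = [xm,xm+2]×[H−1,H]` right of the corner): `(xm,H)` right twice,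
down, left to `(xm+1,H−1)` — 4 bonds replacing the 2-window `w2Y`. [cite: MadrasSlade1993, §3.2 (proof of Theorem 3.2.3: local surgery)] -/
def offY : ℕ → ℤ × ℤ
  | 0 => (0, 0) | 1 => (1, 0) | 2 => (2, 0) | 3 => (2, -1) | _ => (1, -1)

/-- Table Y is a brick-wall path (given the top-corner parity `xm + H` odd). [cite: EntingJensen2009, §7.4.2, Fig. 7.10] -/
theorem offY_adj (hpar : (xm + H) % 2 = 1) {s : ℕ} (hs : s < 4) :
    brickWallGraph.Adj (pt (xm + (offY s).1) (H + (offY s).2)) (pt (xm + (offY (s + 1)).1) (H + (offY (s + 1)).2)) := by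
  interval_cases s <;> simp only [offY] <;> exact adj_pt_iff.2 (by omega)

/-- Table Y is injective on `[0,4]`. [cite: MadrasSlade1993, §3.2] -/
theorem offY_inj {s s' : ℕ} (hs : s ≤ 4) (hs' : s' ≤ 4)
    (h : pt (xm + (offY s).1) (H + (offY s).2) = pt (xm + (offY s').1) (H + (offY s').2)) : s = s' := by
  interval_cases s <;> interval_cases s' <;> simp only [offY] at h <;>
    first | rfl | (obtain ⟨h1, h2⟩ := pt_inj.1 h; omega)

/-- **Case Y surgery is admissible**: for `xm ≥ 1`, the window `(xm,H)(xm,H−1)(xm+1,H−1)` on `ω` and `(xm+2, H−1)` NOT a site of `ω`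
(door note, case Y1a: this holds when `(xm+1,H−1)` continues down), the `+2` flip across `cE` satisfies `SpliceAddOK n 2 2`.
[cite: MadrasSlade1993, §3.2 (proof of Theorem 3.2.3: local surgery)] -/
theorem spliceOK_Y (hpar : (xm + H) % 2 = 1) (hx : 1 ≤ xm)
    (hmaxH : ∀ i, i ≤ n → ω i 1 ≤ H) (hmaxX : ∀ i, i ≤ n → ω i 1 = H → ω i 0 ≤ xm)
    (hE : ∀ i, i ≤ n → ω i ≠ pt (xm + 2) (H - 1))
    (hw : ∀ s, s ≤ 2 → ω (j + s) = tpath w2Y 2 xm H fwd s) (hwnd : j + 2 ≤ n) :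
    SpliceAddOK n 2 2 ω j (tpath offY 4 xm H fwd) := by
  refine spliceAddOK_of_tables (L := 2) (K := 2) (w := w2Y) (by norm_num) (by rfl) (by rfl) (fun s hs => offY_adj hpar hs)
    (fun s s' hs hs' h => offY_inj hs hs' h) (fun u hu0 hu1 i hi _ => ?_) (fun u hu => ?_) hw hwnd
  · interval_cases u <;> simp only [offY]
    · exact ne_of_high hmaxH hmaxX (by omega) hi
    · exact ne_of_high hmaxH hmaxX (by omega) hi
    · rw [show H + -1 = H - 1 by ring]; exact fun h => hE i hi h.symm
  · interval_cases u <;> simp only [offY] <;> exact s2_lexNonneg_pt (by omega)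

/-- **The case-Y image is a canonical `(n+3)`-gon.** [cite: MadrasSlade1993, §3.2 (proof of Theorem 3.2.3)] -/
theorem spliceY_mem_canonEnd (hω : ω ∈ canonEnd n) (hpar : (xm + H) % 2 = 1) (hx : 1 ≤ xm)
    (hmaxH : ∀ i, i ≤ n → ω i 1 ≤ H) (hmaxX : ∀ i, i ≤ n → ω i 1 = H → ω i 0 ≤ xm)
    (hE : ∀ i, i ≤ n → ω i ≠ pt (xm + 2) (H - 1))
    (hw : ∀ s, s ≤ 2 → ω (j + s) = tpath w2Y 2 xm H fwd s) (hwnd : j + 2 ≤ n) :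
    spliceAdd 2 2 ω (tpath offY 4 xm H fwd) j ∈ canonEnd (n + 2) :=
  spliceAdd_mem_canonEnd hω (spliceOK_Y hpar hx hmaxH hmaxX hE hw hwnd)

/-- **Case Y1a freshness**: if `(xm+1, H−1) = ω a` is an interior site whose two walk-neighbours are `(xm, H−1)` and `(xm+1, H−2)`
(the walk steps down after it), then `(xm+2, H−1)` is NOT a site of `ω`: its only possible walk-neighbours are `(xm+1,H−1)` and
`(xm+3,H−1)` (up is `(xm+2,H)`, right of the top corner; down is not a brick-wall bond), so it would be adjacent on the walk to `ω a`,
whose neighbours are already spoken for. [cite: EntingJensen2009, §7.4.2, Fig. 7.10 (brickwork form of the honeycomb lattice)] -/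
theorem caseY_free (hω : ω ∈ endAt n (Pi.single 0 1 : Site 2)) (hpar : (xm + H) % 2 = 1) (hx : 1 ≤ xm)
    (hmaxH : ∀ i, i ≤ n → ω i 1 ≤ H) (hmaxX : ∀ i, i ≤ n → ω i 1 = H → ω i 0 ≤ xm)
    {a : ℕ} (ha1 : 1 ≤ a) (han : a + 1 ≤ n) (ha : ω a = pt (xm + 1) (H - 1))
    (hnb : (ω (a - 1) = pt xm (H - 1) ∧ ω (a + 1) = pt (xm + 1) (H - 2)) ∨
      (ω (a + 1) = pt xm (H - 1) ∧ ω (a - 1) = pt (xm + 1) (H - 2))) :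
    ∀ t, t ≤ n → ω t ≠ pt (xm + 2) (H - 1) := by
  obtain ⟨⟨h0, -, hbw, hinj⟩, hn'⟩ := mem_endAt_iff.1 hω
  intro t ht hωt
  have ht0 : t ≠ 0 := by rintro rfl; rw [h0] at hωt; have := congrFun hωt 0; simp at this; omega
  have htn : t ≠ n := by rintro rfl; rw [hn'] at hωt; have := congrFun hωt 0; simp at this; omega
  -- the walk-neighbours of `ω t` are `(xm+1,H−1)` or `(xm+3,H−1)`
  have key : ∀ z : Site 2, brickWallGraph.Adj (ω t) z → (∃ i, i ≤ n ∧ ω i = z) →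
      z = pt (xm + 1) (H - 1) ∨ z = pt (xm + 3) (H - 1) := by
    intro z hadj ⟨i, hi, hiz⟩
    have hzH : z 1 ≤ H := by rw [← hiz]; exact hmaxH i hi
    have hzX : z 1 = H → z 0 ≤ xm := by rw [← hiz]; exact hmaxX i hi
    rw [hωt] at hadj
    rcases adj_cases hadj with ⟨hz0, hz1⟩ | ⟨hz0, hz1⟩ | hz0
    · right; rw [s2_site_eq_iff]; simp only [pt_apply_zero, pt_apply_one] at hz0 hz1 ⊢; omega
    · left; rw [s2_site_eq_iff]; simp only [pt_apply_zero, pt_apply_one] at hz0 hz1 ⊢; omega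
    · exfalso
      rcases vertical_cases hadj hz0 with ⟨hy, hp⟩ | ⟨hy, hp⟩
      · simp only [pt_apply_zero, pt_apply_one] at hy hz0; have := hzX (by omega); omega
      · simp only [pt_apply_zero, pt_apply_one] at hy hp hz0; omega
  have hp := key _ (by have := hbw (t - 1) (by omega); rw [show t - 1 + 1 = t by omega] at this; exact this.symm) ⟨t - 1, by omega, rfl⟩
  have hs := key _ (hbw t (by omega)) ⟨t + 1, by omega, rfl⟩
  have hne : ω (t - 1) ≠ ω (t + 1) := by
    intro h; have := hinj (show t - 1 ∈ {i | i ≤ n} by simp; omega) (show t + 1 ∈ {i | i ≤ n} by simp; omega) h; omega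
  -- one of them is `ω a`; then `t = a ± 1`, whose sites are known and differ from `(xm+2, H−1)`
  have hta : t - 1 = a ∨ t + 1 = a := by
    rcases hp with hp | hp
    · left; rw [← ha] at hp; exact hinj (show t - 1 ∈ {i | i ≤ n} by simp; omega) (show a ∈ {i | i ≤ n} by simp; omega) hp
    · rcases hs with hs | hs
      · right; rw [← ha] at hs; exact hinj (show t + 1 ∈ {i | i ≤ n} by simp; omega) (show a ∈ {i | i ≤ n} by simp; omega) hs
      · exact absurd (hp.trans hs.symm) hne
  rcases hta with hta | hta
  · have : t = a + 1 := by omega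
    subst this
    rcases hnb with ⟨-, h⟩ | ⟨h, -⟩ <;> · rw [h] at hωt; have := pt_inj.1 hωt; omega
  · have : t = a - 1 := by omega
    subst this
    rcases hnb with ⟨h, -⟩ | ⟨-, h⟩ <;> · rw [h] at hωt; have := pt_inj.1 hωt; omega

/-- **Step two, case X — existence**: a canonical rooted polygon (`n ≥ 5`) whose top run continues left of the top-right brick, i.e.
`(xm−3, H)` is a site of `ω` where `(xm, H)` is the top corner, has a canonical `+2` image.  (The top corner is recovered inside the
proof; `H`, `xm` are pinned by their extremal properties.) [cite: MadrasSlade1993, §3.2 (proof of Theorem 3.2.3)] -/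
theorem stepTwo_exists_X (hω : ω ∈ canonEnd n) (hn : 5 ≤ n) {H xm : ℤ}
    (hmaxH : ∀ i, i ≤ n → ω i 1 ≤ H) (hmaxX : ∀ i, i ≤ n → ω i 1 = H → ω i 0 ≤ xm)
    (hv : ∃ i, i ≤ n ∧ ω i = pt xm H) (hX : ∃ t, t ≤ n ∧ ω t = pt (xm - 3) H) :
    ∃ (j : ℕ) (fwd : Bool), spliceAdd 2 2 ω (tpath offX 4 xm H fwd) j ∈ canonEnd (n + 2) := by
  obtain ⟨hE, hlex⟩ := mem_canonEnd.1 hω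
  obtain ⟨⟨h0, -, hbw, hinj⟩, hn'⟩ := mem_endAt_iff.1 hE
  have hcol := col_nonneg_of_mem_canonEnd hω
  obtain ⟨H', xm', i₀, hi₀, hi₀n, hv', hH1, hmaxH', hmaxX', hdir⟩ := exists_top_corner hω (by omega)
  -- the two corners coincide
  obtain ⟨i₁, hi₁, hv₁⟩ := hv
  have hHH : H' = H := by
    have b := hmaxH' i₁ hi₁; have c := hmaxH i₀ (by omega)
    rw [hv₁] at b; rw [hv'] at c; simp only [pt_apply_one] at b c; omega
  subst hHH
  have hxx : xm' = xm := by
    have a := hmaxX i₁ hi₁ (by rw [hv₁]; simp); have b := hmaxX' i₀ (by omega) (by rw [hv']; simp)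
    have c := hmaxX' i₁ hi₁ (by rw [hv₁]; simp); have d := hmaxX i₀ (by omega) (by rw [hv']; simp)
    rw [hv₁] at a c; rw [hv'] at b d; simp only [pt_apply_zero] at a b c d; omega
  subst hxx
  obtain ⟨t, ht, hωt⟩ := hX
  have hx3 : 3 ≤ xm' := by have := hcol t; rw [hωt] at this; simp only [pt_apply_zero] at this; omega
  rcases hdir with ⟨hp, hs⟩ | ⟨hs', hp'⟩
  · have hpar : (xm' + H') % 2 = 1 := by
      have hvc := vertical_cases (hbw i₀ (by omega)) (by rw [hv', hs]; simp)
      rw [hv', hs] at hvc; simp only [pt_apply_zero, pt_apply_one] at hvc; omega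
    obtain ⟨hi₀2, h2⟩ := top_corner_pred hω hi₀ hi₀n hv' hmaxH' hp hs
    obtain ⟨hi₀3, h3⟩ := caseA_fwd hE hpar hH1 hmaxH' hi₀2 hi₀n h2 hp ht hωt
    refine ⟨i₀ - 3, true, spliceX_mem_canonEnd hω hpar hx3 (by omega) hmaxH' hmaxX' ?_ (by omega)⟩
    intro s hsL
    interval_cases s
    · exact tpath_eq (by rw [show i₀ - 3 + 0 = i₀ - 3 by omega, h3]) (by simp [rd, w6A])
    · exact tpath_eq (by rw [show i₀ - 3 + 1 = i₀ - 2 by omega, h2]) (by simp [rd, w6A])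
    · exact tpath_eq (by rw [show i₀ - 3 + 2 = i₀ - 1 by omega, hp]) (by simp [rd, w6A])
  · have hpar : (xm' + H') % 2 = 1 := by
      have hvc := vertical_cases (hbw (i₀ - 1) (by omega)) (by rw [show i₀ - 1 + 1 = i₀ by omega, hv', hp']; simp)
      rw [show i₀ - 1 + 1 = i₀ by omega, hv', hp'] at hvc; simp only [pt_apply_zero, pt_apply_one] at hvc; omega
    obtain ⟨hi₀2, h2⟩ := top_corner_succ hω hi₀ hi₀n hv' hmaxH' hs' hp'
    obtain ⟨hi₀3, h3⟩ := caseA_bwd hE hpar hH1 hmaxH' hi₀2 h2 hs' ht hωt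
    refine ⟨i₀ + 1, false, spliceX_mem_canonEnd hω hpar hx3 (by omega) hmaxH' hmaxX' ?_ (by omega)⟩
    intro s hsL
    interval_cases s
    · exact tpath_eq (by rw [add_zero, hs']) (by simp [rd, w6A])
    · exact tpath_eq (by rw [show i₀ + 1 + 1 = i₀ + 2 by omega, h2]) (by simp [rd, w6A])
    · exact tpath_eq (by rw [show i₀ + 1 + 2 = i₀ + 3 by omega, h3]) (by simp [rd, w6A])

/-- **Step two, case Y1a — existence, forward orientation**: at the top corner `ω i₀ = (xm, H)` the walk steps down, right, down
(`ω (i₀+1) = (xm,H−1)`, `ω (i₀+2) = (xm+1,H−1)`, `ω (i₀+3) = (xm+1,H−2)`); then the `+2` flip across `cE` gives a canonical image.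
[cite: MadrasSlade1993, §3.2 (proof of Theorem 3.2.3)] -/
theorem stepTwo_exists_Y_fwd (hω : ω ∈ canonEnd n) {H xm : ℤ} {i₀ : ℕ} (hx : 1 ≤ xm) (hi₀n : i₀ + 3 ≤ n)
    (hmaxH : ∀ i, i ≤ n → ω i 1 ≤ H) (hmaxX : ∀ i, i ≤ n → ω i 1 = H → ω i 0 ≤ xm)
    (hv : ω i₀ = pt xm H) (h1 : ω (i₀ + 1) = pt xm (H - 1)) (h2 : ω (i₀ + 2) = pt (xm + 1) (H - 1))
    (h3 : ω (i₀ + 3) = pt (xm + 1) (H - 2)) :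
    spliceAdd 2 2 ω (tpath offY 4 xm H true) i₀ ∈ canonEnd (n + 2) := by
  obtain ⟨hE, -⟩ := mem_canonEnd.1 hω
  obtain ⟨⟨h0, -, hbw, hinj⟩, hn'⟩ := mem_endAt_iff.1 hE
  have hpar : (xm + H) % 2 = 1 := by
    have hvc := vertical_cases (hbw i₀ (by omega)) (by rw [hv, h1]; simp)
    rw [hv, h1] at hvc; simp only [pt_apply_zero, pt_apply_one] at hvc; omega
  have hE' := caseY_free hE hpar hx hmaxH hmaxX (a := i₀ + 2) (by omega) (by omega) h2
    (Or.inl ⟨by rw [show i₀ + 2 - 1 = i₀ + 1 by omega, h1], by rw [show i₀ + 2 + 1 = i₀ + 3 by omega, h3]⟩)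
  refine spliceY_mem_canonEnd hω hpar hx hmaxH hmaxX hE' ?_ (by omega)
  intro s hsL
  interval_cases s
  · exact tpath_eq (by rw [add_zero, hv]) (by simp [rd, w2Y])
  · exact tpath_eq (by rw [h1]) (by simp [rd, w2Y])
  · exact tpath_eq (by rw [h2]) (by simp [rd, w2Y])

/-- **Step two, case Y1a — existence, backward orientation** (`ω (i₀−1) = (xm,H−1)`, `ω (i₀−2) = (xm+1,H−1)`, `ω (i₀−3) = (xm+1,H−2)`).
[cite: MadrasSlade1993, §3.2 (proof of Theorem 3.2.3)] -/
theorem stepTwo_exists_Y_bwd (hω : ω ∈ canonEnd n) {H xm : ℤ} {i₀ : ℕ} (hx : 1 ≤ xm) (hi₀ : 3 ≤ i₀) (hi₀n : i₀ ≤ n)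
    (hmaxH : ∀ i, i ≤ n → ω i 1 ≤ H) (hmaxX : ∀ i, i ≤ n → ω i 1 = H → ω i 0 ≤ xm)
    (hv : ω i₀ = pt xm H) (h1 : ω (i₀ - 1) = pt xm (H - 1)) (h2 : ω (i₀ - 2) = pt (xm + 1) (H - 1))
    (h3 : ω (i₀ - 3) = pt (xm + 1) (H - 2)) :
    spliceAdd 2 2 ω (tpath offY 4 xm H false) (i₀ - 2) ∈ canonEnd (n + 2) := by
  obtain ⟨hE, -⟩ := mem_canonEnd.1 hω
  obtain ⟨⟨h0, -, hbw, hinj⟩, hn'⟩ := mem_endAt_iff.1 hE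
  have hpar : (xm + H) % 2 = 1 := by
    have hvc := vertical_cases (hbw (i₀ - 1) (by omega)) (by rw [show i₀ - 1 + 1 = i₀ by omega, hv, h1]; simp)
    rw [show i₀ - 1 + 1 = i₀ by omega, hv, h1] at hvc; simp only [pt_apply_zero, pt_apply_one] at hvc; omega
  have hE' := caseY_free hE hpar hx hmaxH hmaxX (a := i₀ - 2) (by omega) (by omega) h2
    (Or.inr ⟨by rw [show i₀ - 2 + 1 = i₀ - 1 by omega, h1], by rw [show i₀ - 2 - 1 = i₀ - 3 by omega, h3]⟩)
  refine spliceY_mem_canonEnd hω hpar hx hmaxH hmaxX hE' ?_ (by omega)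
  intro s hsL
  interval_cases s
  · exact tpath_eq (by rw [add_zero, h2]) (by simp [rd, w2Y])
  · exact tpath_eq (by rw [show i₀ - 2 + 1 = i₀ - 1 by omega, h1]) (by simp [rd, w2Y])
  · exact tpath_eq (by rw [show i₀ - 2 + 2 = i₀ by omega, hv]) (by simp [rd, w2Y])

/-- **Reading the source off the image** (K-general form of `eq_of_splice6_eq`): two polygons with the same window position, the same
window table and the same replacement table, whose spliced images agree, are equal. [cite: MadrasSlade1993, §3.2 (proof of Theorem 3.2.3:
"Q can be unambiguously determined")] -/
theorem eq_of_spliceAdd_eq {ω' : ℕ → Site 2} {off w : ℕ → ℤ × ℤ}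
    (hω : ω ∈ endAt n (Pi.single 0 1 : Site 2)) (hω' : ω' ∈ endAt n (Pi.single 0 1 : Site 2))
    (hP : SpliceAddOK n K L ω j (tpath off (L + K) xm H fwd)) (hP' : SpliceAddOK n K L ω' j (tpath off (L + K) xm H fwd))
    (hw : ∀ s, s ≤ L → ω (j + s) = tpath w L xm H fwd s) (hw' : ∀ s, s ≤ L → ω' (j + s) = tpath w L xm H fwd s)
    (h : spliceAdd K L ω (tpath off (L + K) xm H fwd) j = spliceAdd K L ω' (tpath off (L + K) xm H fwd) j) : ω = ω' := by
  have hwnd := hP.wnd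
  have h1 : ∀ i, i ≤ n → ω i = ω' i := by
    intro i hi
    rcases le_or_gt i j with hij | hij
    · have := congrFun h i; rwa [spliceAdd_of_le hij, spliceAdd_of_le hij] at this
    rcases Nat.lt_or_ge i (j + L) with h2 | h2
    · obtain ⟨s, rfl⟩ : ∃ s, i = j + s := ⟨i - j, by omega⟩
      rw [hw s (by omega), hw' s (by omega)]
    · have := congrFun h (i + K)
      rwa [spliceAdd_of_ge hP.finish (by omega), spliceAdd_of_ge hP'.finish (by omega), show i + K - K = i by omega] at this
  funext i
  rcases le_or_gt i n with hi | hi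
  · exact h1 i hi
  · rw [(mem_endAt_iff.1 hω).1.2.1 i hi.le, (mem_endAt_iff.1 hω').1.2.1 i hi.le]; exact h1 n le_rfl

/-- **Below the top corner, forward, first step**: after `ω i₀ = (xm,H)`, `ω (i₀+1) = (xm,H−1)` the walk continues horizontally,
`ω (i₀+2) = (xm−1,H−1)` or `(xm+1,H−1)` (up is `ω i₀` again, down is not a brick-wall bond). General-`xm` form of STEP-SIX's
`caseC_fwd_step`. [cite: EntingJensen2009, §7.4.2, Fig. 7.10 (brickwork form of the honeycomb lattice)] -/
theorem caseY_step1_fwd (hω : ω ∈ endAt n (Pi.single 0 1 : Site 2)) (hpar : (xm + H) % 2 = 1) (hx : 2 ≤ xm)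
    (hi₀n : i₀ + 1 ≤ n) (hv : ω i₀ = pt xm H) (hs : ω (i₀ + 1) = pt xm (H - 1)) :
    i₀ + 2 ≤ n ∧ (ω (i₀ + 2) = pt (xm - 1) (H - 1) ∨ ω (i₀ + 2) = pt (xm + 1) (H - 1)) := by
  obtain ⟨⟨h0, -, hbw, hinj⟩, hn'⟩ := mem_endAt_iff.1 hω
  have hne : i₀ + 1 ≠ n := by
    intro h; rw [h, hn'] at hs; have := congrFun hs 0; simp at this; omega
  refine ⟨by omega, ?_⟩
  have hadj : brickWallGraph.Adj (ω (i₀ + 1)) (ω (i₀ + 2)) := hbw (i₀ + 1) (by omega)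
  rw [hs] at hadj
  have hback : ω (i₀ + 2) ≠ ω i₀ := by
    intro h; have := hinj (show i₀ + 2 ∈ {i | i ≤ n} by simp; omega) (show i₀ ∈ {i | i ≤ n} by simp; omega) h; omega
  rcases adj_cases hadj with ⟨hz0, hz1⟩ | ⟨hz0, hz1⟩ | hz0
  · right; rw [s2_site_eq_iff]; simp only [pt_apply_zero, pt_apply_one] at hz0 hz1 ⊢; omega
  · left; rw [s2_site_eq_iff]; simp only [pt_apply_zero, pt_apply_one] at hz0 hz1 ⊢; omega
  · exfalso
    rcases vertical_cases hadj hz0 with ⟨hy, hp⟩ | ⟨hy, hp⟩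
    · apply hback; rw [hv, s2_site_eq_iff]; simp only [pt_apply_zero, pt_apply_one] at hz0 hy ⊢; omega
    · simp only [pt_apply_zero, pt_apply_one] at hz0 hy hp; omega

/-- **Below the top corner, forward, second step to the right**: after `(xm,H−1) → (xm+1,H−1)` the walk continues to `(xm+2,H−1)`
(case Y1b of the door note) or down to `(xm+1,H−2)` (case Y1a); up would be `(xm+1,H)`, right of the top corner.
[cite: EntingJensen2009, §7.4.2, Fig. 7.10 (brickwork form of the honeycomb lattice)] -/
theorem caseY_step2_fwd (hω : ω ∈ endAt n (Pi.single 0 1 : Site 2)) (hpar : (xm + H) % 2 = 1) (hx : 2 ≤ xm)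
    (hmaxX : ∀ i, i ≤ n → ω i 1 = H → ω i 0 ≤ xm)
    (hi₀n : i₀ + 2 ≤ n) (hs : ω (i₀ + 1) = pt xm (H - 1)) (hs2 : ω (i₀ + 2) = pt (xm + 1) (H - 1)) :
    i₀ + 3 ≤ n ∧ (ω (i₀ + 3) = pt (xm + 2) (H - 1) ∨ ω (i₀ + 3) = pt (xm + 1) (H - 2)) := by
  obtain ⟨⟨h0, -, hbw, hinj⟩, hn'⟩ := mem_endAt_iff.1 hω
  have hne : i₀ + 2 ≠ n := by
    intro h; rw [h, hn'] at hs2; have := congrFun hs2 0; simp at this; omega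
  refine ⟨by omega, ?_⟩
  have hadj : brickWallGraph.Adj (ω (i₀ + 2)) (ω (i₀ + 3)) := hbw (i₀ + 2) (by omega)
  rw [hs2] at hadj
  have hback : ω (i₀ + 3) ≠ ω (i₀ + 1) := by
    intro h; have := hinj (show i₀ + 3 ∈ {i | i ≤ n} by simp; omega) (show i₀ + 1 ∈ {i | i ≤ n} by simp; omega) h; omega
  have hX3 := hmaxX (i₀ + 3) (by omega)
  rcases adj_cases hadj with ⟨hz0, hz1⟩ | ⟨hz0, hz1⟩ | hz0
  · left; rw [s2_site_eq_iff]; simp only [pt_apply_zero, pt_apply_one] at hz0 hz1 ⊢; omega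
  · exfalso; apply hback; rw [hs, s2_site_eq_iff]; simp only [pt_apply_zero, pt_apply_one] at hz0 hz1 ⊢; omega
  · rcases vertical_cases hadj hz0 with ⟨hy, hp⟩ | ⟨hy, hp⟩
    · -- up: `(xm+1, H)` is right of the top corner
      exfalso; simp only [pt_apply_zero, pt_apply_one] at hz0 hy; have := hX3 (by omega); omega
    · right; rw [s2_site_eq_iff]; simp only [pt_apply_zero, pt_apply_one] at hz0 hy ⊢; omega

/-- Backward form of `caseY_step1_fwd`: with `ω (i₀−1) = (xm,H−1)`, `ω (i₀−2)` is `(xm−1,H−1)` or `(xm+1,H−1)` (and `2 ≤ i₀`).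
[cite: EntingJensen2009, §7.4.2, Fig. 7.10 (brickwork form of the honeycomb lattice)] -/
theorem caseY_step1_bwd (hω : ω ∈ endAt n (Pi.single 0 1 : Site 2)) (hpar : (xm + H) % 2 = 1) (hx : 2 ≤ xm)
    (hi₀ : 1 ≤ i₀) (hi₀n : i₀ ≤ n) (hv : ω i₀ = pt xm H) (hs : ω (i₀ - 1) = pt xm (H - 1)) :
    2 ≤ i₀ ∧ (ω (i₀ - 2) = pt (xm - 1) (H - 1) ∨ ω (i₀ - 2) = pt (xm + 1) (H - 1)) := by
  obtain ⟨⟨h0, -, hbw, hinj⟩, hn'⟩ := mem_endAt_iff.1 hω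
  have hne : i₀ - 1 ≠ 0 := by
    intro h; rw [h, h0] at hs; have := congrFun hs 0; simp at this; omega
  refine ⟨by omega, ?_⟩
  have hadj : brickWallGraph.Adj (ω (i₀ - 1)) (ω (i₀ - 2)) := by
    have := hbw (i₀ - 2) (by omega); rw [show i₀ - 2 + 1 = i₀ - 1 by omega] at this; exact this.symm
  rw [hs] at hadj
  have hback : ω (i₀ - 2) ≠ ω i₀ := by
    intro h; have := hinj (show i₀ - 2 ∈ {i | i ≤ n} by simp; omega) (show i₀ ∈ {i | i ≤ n} by simp; omega) h; omega
  rcases adj_cases hadj with ⟨hz0, hz1⟩ | ⟨hz0, hz1⟩ | hz0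
  · right; rw [s2_site_eq_iff]; simp only [pt_apply_zero, pt_apply_one] at hz0 hz1 ⊢; omega
  · left; rw [s2_site_eq_iff]; simp only [pt_apply_zero, pt_apply_one] at hz0 hz1 ⊢; omega
  · exfalso
    rcases vertical_cases hadj hz0 with ⟨hy, hp⟩ | ⟨hy, hp⟩
    · apply hback; rw [hv, s2_site_eq_iff]; simp only [pt_apply_zero, pt_apply_one] at hz0 hy ⊢; omega
    · simp only [pt_apply_zero, pt_apply_one] at hz0 hy hp; omega

/-- Backward form of `caseY_step2_fwd`: with `ω (i₀−1) = (xm,H−1)`, `ω (i₀−2) = (xm+1,H−1)`, the site `ω (i₀−3)` is `(xm+2,H−1)`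
or `(xm+1,H−2)` (and `3 ≤ i₀`). [cite: EntingJensen2009, §7.4.2, Fig. 7.10 (brickwork form of the honeycomb lattice)] -/
theorem caseY_step2_bwd (hω : ω ∈ endAt n (Pi.single 0 1 : Site 2)) (hpar : (xm + H) % 2 = 1) (hx : 2 ≤ xm)
    (hmaxX : ∀ i, i ≤ n → ω i 1 = H → ω i 0 ≤ xm)
    (hi₀ : 2 ≤ i₀) (hi₀n : i₀ ≤ n) (hs : ω (i₀ - 1) = pt xm (H - 1)) (hs2 : ω (i₀ - 2) = pt (xm + 1) (H - 1)) :
    3 ≤ i₀ ∧ (ω (i₀ - 3) = pt (xm + 2) (H - 1) ∨ ω (i₀ - 3) = pt (xm + 1) (H - 2)) := by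
  obtain ⟨⟨h0, -, hbw, hinj⟩, hn'⟩ := mem_endAt_iff.1 hω
  have hne : i₀ - 2 ≠ 0 := by
    intro h; rw [h, h0] at hs2; have := congrFun hs2 0; simp at this; omega
  refine ⟨by omega, ?_⟩
  have hadj : brickWallGraph.Adj (ω (i₀ - 2)) (ω (i₀ - 3)) := by
    have := hbw (i₀ - 3) (by omega); rw [show i₀ - 3 + 1 = i₀ - 2 by omega] at this; exact this.symm
  rw [hs2] at hadj
  have hback : ω (i₀ - 3) ≠ ω (i₀ - 1) := by
    intro h; have := hinj (show i₀ - 3 ∈ {i | i ≤ n} by simp; omega) (show i₀ - 1 ∈ {i | i ≤ n} by simp; omega) h; omega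
  have hX3 := hmaxX (i₀ - 3) (by omega)
  rcases adj_cases hadj with ⟨hz0, hz1⟩ | ⟨hz0, hz1⟩ | hz0
  · left; rw [s2_site_eq_iff]; simp only [pt_apply_zero, pt_apply_one] at hz0 hz1 ⊢; omega
  · exfalso; apply hback; rw [hs, s2_site_eq_iff]; simp only [pt_apply_zero, pt_apply_one] at hz0 hz1 ⊢; omega
  · rcases vertical_cases hadj hz0 with ⟨hy, hp⟩ | ⟨hy, hp⟩
    · exfalso; simp only [pt_apply_zero, pt_apply_one] at hz0 hy; have := hX3 (by omega); omega
    · right; rw [s2_site_eq_iff]; simp only [pt_apply_zero, pt_apply_one] at hz0 hy ⊢; omega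

/-- **What the two top-corner moves cover (existence)**: for a canonical rooted polygon `ω ∈ canonEnd n`, `n ≥ 5`, with top corner data
`(H, xm)` (extremal properties + attained), EITHER case X applies (`(xm−3,H) ∈ ω` — then `stepTwo_exists_X`), OR the walk below the
corner steps right then down (case Y1a — then `stepTwo_exists_Y_fwd/_bwd`), OR we are in the RESIDUE: `(xm−3,H) ∉ ω` and below the
corner the walk steps LEFT (Y2) or right-right (Y1b).  This lemma records the classification; the residue is the open part of the line.
[cite: MadrasSlade1993, §3.2 (proof of Theorem 3.2.3)] -/
theorem stepTwo_classify (hω : ω ∈ canonEnd n) (hn : 5 ≤ n) :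
    ∃ (H xm : ℤ) (i₀ : ℕ) (fwd : Bool), 1 ≤ i₀ ∧ i₀ + 1 ≤ n ∧ ω i₀ = pt xm H ∧ 2 ≤ xm ∧ 1 ≤ H ∧
      (∀ i, i ≤ n → ω i 1 ≤ H) ∧ (∀ i, i ≤ n → ω i 1 = H → ω i 0 ≤ xm) ∧
      ( -- case X: an image exists by `stepTwo_exists_X`
        (∃ t, t ≤ n ∧ ω t = pt (xm - 3) H) ∨
        -- case Y1a, forward / backward: an image exists by `stepTwo_exists_Y_fwd` / `_bwd`
        (fwd = true ∧ i₀ + 3 ≤ n ∧ ω (i₀ + 1) = pt xm (H - 1) ∧ ω (i₀ + 2) = pt (xm + 1) (H - 1) ∧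
          ω (i₀ + 3) = pt (xm + 1) (H - 2)) ∨
        (fwd = false ∧ 3 ≤ i₀ ∧ ω (i₀ - 1) = pt xm (H - 1) ∧ ω (i₀ - 2) = pt (xm + 1) (H - 1) ∧
          ω (i₀ - 3) = pt (xm + 1) (H - 2)) ∨
        -- RESIDUE (open): no `(xm−3,H)`, and below the corner the walk goes left, or right twice
        ((∀ t, t ≤ n → ω t ≠ pt (xm - 3) H) ∧
          ((fwd = true ∧ i₀ + 2 ≤ n ∧ ω (i₀ + 1) = pt xm (H - 1) ∧
              (ω (i₀ + 2) = pt (xm - 1) (H - 1) ∨ (i₀ + 3 ≤ n ∧ ω (i₀ + 2) = pt (xm + 1) (H - 1) ∧ ω (i₀ + 3) = pt (xm + 2) (H - 1)))) ∨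
           (fwd = false ∧ 2 ≤ i₀ ∧ ω (i₀ - 1) = pt xm (H - 1) ∧
              (ω (i₀ - 2) = pt (xm - 1) (H - 1) ∨ (3 ≤ i₀ ∧ ω (i₀ - 2) = pt (xm + 1) (H - 1) ∧ ω (i₀ - 3) = pt (xm + 2) (H - 1))))))) := by
  obtain ⟨hE, hlex⟩ := mem_canonEnd.1 hω
  obtain ⟨⟨h0, -, hbw, hinj⟩, hn'⟩ := mem_endAt_iff.1 hE
  have hcol := col_nonneg_of_mem_canonEnd hω
  obtain ⟨H, xm, i₀, hi₀, hi₀n, hv, hH1, hmaxH, hmaxX, hdir⟩ := exists_top_corner hω (by omega)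
  rcases hdir with ⟨hp, hs⟩ | ⟨hs', hp'⟩
  · -- forward
    have hpar : (xm + H) % 2 = 1 := by
      have hvc := vertical_cases (hbw i₀ (by omega)) (by rw [hv, hs]; simp)
      rw [hv, hs] at hvc; simp only [pt_apply_zero, pt_apply_one] at hvc; omega
    obtain ⟨hi₀2, h2⟩ := top_corner_pred hω hi₀ hi₀n hv hmaxH hp hs
    have hx2 : 2 ≤ xm := by have := hcol (i₀ - 2); rw [h2] at this; simp only [pt_apply_zero] at this; omega
    refine ⟨H, xm, i₀, true, hi₀, hi₀n, hv, hx2, hH1, hmaxH, hmaxX, ?_⟩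
    by_cases hX : ∃ t, t ≤ n ∧ ω t = pt (xm - 3) H
    · exact Or.inl hX
    push Not at hX
    obtain ⟨hi₀2', hstep⟩ := caseY_step1_fwd hE hpar hx2 hi₀n hv hs
    rcases hstep with hL | hR
    · exact Or.inr (Or.inr (Or.inr ⟨hX, Or.inl ⟨rfl, hi₀2', hs, Or.inl hL⟩⟩))
    · obtain ⟨hi₀3, hstep2⟩ := caseY_step2_fwd hE hpar hx2 hmaxX hi₀2' hs hR
      rcases hstep2 with hRR | hRD
      · exact Or.inr (Or.inr (Or.inr ⟨hX, Or.inl ⟨rfl, hi₀2', hs, Or.inr ⟨hi₀3, hR, hRR⟩⟩⟩))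
      · exact Or.inr (Or.inl ⟨rfl, hi₀3, hs, hR, hRD⟩)
  · -- backward
    have hpar : (xm + H) % 2 = 1 := by
      have hvc := vertical_cases (hbw (i₀ - 1) (by omega)) (by rw [show i₀ - 1 + 1 = i₀ by omega, hv, hp']; simp)
      rw [show i₀ - 1 + 1 = i₀ by omega, hv, hp'] at hvc; simp only [pt_apply_zero, pt_apply_one] at hvc; omega
    obtain ⟨hi₀2, h2⟩ := top_corner_succ hω hi₀ hi₀n hv hmaxH hs' hp'
    have hx2 : 2 ≤ xm := by have := hcol (i₀ + 2); rw [h2] at this; simp only [pt_apply_zero] at this; omega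
    refine ⟨H, xm, i₀, false, hi₀, hi₀n, hv, hx2, hH1, hmaxH, hmaxX, ?_⟩
    by_cases hX : ∃ t, t ≤ n ∧ ω t = pt (xm - 3) H
    · exact Or.inl hX
    push Not at hX
    obtain ⟨hi₀2', hstep⟩ := caseY_step1_bwd hE hpar hx2 hi₀ (by omega) hv hp'
    rcases hstep with hL | hR
    · exact Or.inr (Or.inr (Or.inr ⟨hX, Or.inr ⟨rfl, hi₀2', hp', Or.inl hL⟩⟩))
    · obtain ⟨hi₀3, hstep2⟩ := caseY_step2_bwd hE hpar hx2 hmaxX hi₀2' (by omega) hp' hR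
      rcases hstep2 with hRR | hRD
      · exact Or.inr (Or.inr (Or.inr ⟨hX, Or.inr ⟨rfl, hi₀2', hp', Or.inr ⟨hi₀3, hR, hRR⟩⟩⟩))
      · exact Or.inr (Or.inr (Or.inl ⟨rfl, hi₀3, hp', hR, hRD⟩))

/-- **Existence outside the residue**: if the classification of `stepTwo_classify` does not land in the residue, `ω` has a canonical
`+2` image. (Packaging of `stepTwo_exists_X` / `stepTwo_exists_Y_fwd` / `stepTwo_exists_Y_bwd`.) [cite: MadrasSlade1993, §3.2 (proof of Theorem 3.2.3)] -/
theorem stepTwo_exists_of_not_residue (hω : ω ∈ canonEnd n) (hn : 5 ≤ n) {H xm : ℤ} {i₀ : ℕ} {fwd : Bool}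
    (hi₀n : i₀ + 1 ≤ n) (hv : ω i₀ = pt xm H) (hx2 : 2 ≤ xm)
    (hmaxH : ∀ i, i ≤ n → ω i 1 ≤ H) (hmaxX : ∀ i, i ≤ n → ω i 1 = H → ω i 0 ≤ xm)
    (hcase : (∃ t, t ≤ n ∧ ω t = pt (xm - 3) H) ∨
        (fwd = true ∧ i₀ + 3 ≤ n ∧ ω (i₀ + 1) = pt xm (H - 1) ∧ ω (i₀ + 2) = pt (xm + 1) (H - 1) ∧
          ω (i₀ + 3) = pt (xm + 1) (H - 2)) ∨
        (fwd = false ∧ 3 ≤ i₀ ∧ ω (i₀ - 1) = pt xm (H - 1) ∧ ω (i₀ - 2) = pt (xm + 1) (H - 1) ∧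
          ω (i₀ - 3) = pt (xm + 1) (H - 2))) :
    ∃ W, W ∈ canonEnd (n + 2) := by
  rcases hcase with hX | ⟨-, h3n, h1, h2, h3⟩ | ⟨-, h3, h1, h2, h3'⟩
  · obtain ⟨j, fwd', hW⟩ := stepTwo_exists_X hω hn hmaxH hmaxX ⟨i₀, by omega, hv⟩ hX
    exact ⟨_, hW⟩
  · exact ⟨_, stepTwo_exists_Y_fwd hω (by omega) h3n hmaxH hmaxX hv h1 h2 h3⟩
  · exact ⟨_, stepTwo_exists_Y_bwd hω (by omega) h3 (by omega) hmaxH hmaxX hv h1 h2 h3'⟩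

/-- Sites of the `K`-spliced walk: an `ω`-site outside the window, or a site of the new path. [cite: MadrasSlade1993, §3.2] -/
theorem spliceAdd_site_cases {π : ℕ → Site 2} (hP : SpliceAddOK n K L ω j π) {i : ℕ} (hi : i ≤ n + K) :
    (∃ a, a ≤ n ∧ (a ≤ j ∨ j + L ≤ a) ∧ spliceAdd K L ω π j i = ω a) ∨ (∃ s, s ≤ L + K ∧ spliceAdd K L ω π j i = π s) := by
  have hwnd := hP.wnd
  rcases le_or_gt i j with h1 | h1
  · exact Or.inl ⟨i, by omega, Or.inl h1, spliceAdd_of_le h1⟩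
  rcases Nat.lt_or_ge i (j + L + K) with h2 | h2
  · obtain ⟨s, rfl⟩ : ∃ s, i = j + s := ⟨i - j, by omega⟩
    exact Or.inr ⟨s, by omega, spliceAdd_mid hP.start (by omega)⟩
  · exact Or.inl ⟨i - K, by omega, Or.inr (by omega), spliceAdd_of_ge hP.finish h2⟩

/-- **Top corner of a `K`-spliced image from its table** (general `dH ≥ 0` form of STEP-SIX's `topAt_splice`): if every table site has
height offset `≤ dH`, those at offset `dH` have abscissa offset `≤ dX`, the entry `u₀` is `(dX, dH)`, and — when `dH = 0` — also
`dX ≥ 0` (so the old top row does not beat the new corner), then the image's intrinsic top corner is `(xm + dX, H + dH)` at time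
`j + rd fwd (L+K) u₀`. [cite: MadrasSlade1993, §3.2 (proof of Theorem 3.2.3: the lexicographically largest point)] -/
theorem topAt_spliceAdd {off : ℕ → ℤ × ℤ} (hmaxH : ∀ i, i ≤ n → ω i 1 ≤ H) (hmaxX : ∀ i, i ≤ n → ω i 1 = H → ω i 0 ≤ xm)
    (hP : SpliceAddOK n K L ω j (tpath off (L + K) xm H fwd))
    {dH dX : ℤ} (hdH : 0 ≤ dH) (hdX : dH = 0 → 0 ≤ dX)
    (htab : ∀ u, u ≤ L + K → (off u).2 ≤ dH ∧ ((off u).2 = dH → (off u).1 ≤ dX))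
    {u₀ : ℕ} (hu₀ : u₀ ≤ L + K) (hoff : off u₀ = (dX, dH)) :
    TopSix (n + K) (spliceAdd K L ω (tpath off (L + K) xm H fwd) j) (H + dH) (xm + dX) (j + rd fwd (L + K) u₀) := by
  refine ⟨fun i hi => ?_, fun i hi hiH => ?_, by have := hP.wnd; have := rd_le (fwd := fwd) hu₀; omega, ?_⟩
  · rcases spliceAdd_site_cases hP hi with ⟨a, ha, -, hia⟩ | ⟨s, hs, his⟩
    · rw [hia]; have := hmaxH a ha; omega
    · rw [his, tpath, pt_apply_one]; have := (htab _ (rd_le (fwd := fwd) hs)).1; omega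
  · rcases spliceAdd_site_cases hP hi with ⟨a, ha, -, hia⟩ | ⟨s, hs, his⟩
    · rw [hia] at hiH ⊢; have h1 := hmaxH a ha
      have hdH0 : dH = 0 := by omega
      have := hmaxX a ha (by omega); have := hdX hdH0; omega
    · rw [his, tpath, pt_apply_one] at hiH; rw [his, tpath, pt_apply_zero]
      have := (htab _ (rd_le (fwd := fwd) hs)).2 (by omega); omega
  · rw [spliceAdd_mid hP.start (rd_le hu₀), tpath]
    have : rd fwd (L + K) (rd fwd (L + K) u₀) = u₀ := by unfold rd; split_ifs <;> omega
    rw [this, hoff]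

/-- **Top corner of a case-X image**: `(xm − 1, H + 1)`, at table index `3`. [cite: MadrasSlade1993, §3.2] -/
theorem topAt_spliceX (hmaxH : ∀ i, i ≤ n → ω i 1 ≤ H) (hmaxX : ∀ i, i ≤ n → ω i 1 = H → ω i 0 ≤ xm)
    (hP : SpliceAddOK n 2 2 ω j (tpath offX 4 xm H fwd)) :
    TopSix (n + 2) (spliceAdd 2 2 ω (tpath offX 4 xm H fwd) j) (H + 1) (xm + (-1)) (j + rd fwd 4 3) :=
  topAt_spliceAdd hmaxH hmaxX hP (by norm_num) (by omega) (fun u hu => by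
    interval_cases u <;> simp only [offX] <;> omega) (by norm_num) rfl

/-- **Top corner of a case-Y image**: `(xm + 2, H)`, at table index `2`. [cite: MadrasSlade1993, §3.2] -/
theorem topAt_spliceY (hmaxH : ∀ i, i ≤ n → ω i 1 ≤ H) (hmaxX : ∀ i, i ≤ n → ω i 1 = H → ω i 0 ≤ xm)
    (hP : SpliceAddOK n 2 2 ω j (tpath offY 4 xm H fwd)) :
    TopSix (n + 2) (spliceAdd 2 2 ω (tpath offY 4 xm H fwd) j) (H + 0) (xm + 2) (j + rd fwd 4 2) :=
  topAt_spliceAdd hmaxH hmaxX hP le_rfl (fun _ => by norm_num) (fun u hu => by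
    interval_cases u <;> simp only [offY] <;> omega) (by norm_num) rfl

/-- **Signature of a case-X image, forward**: corner `(xm−1,H+1)` at time `j+3`, then DOWN to `(xm−1,H)` at `j+4`, then RIGHT to the
old corner `(xm,H)` at `j+5` (given `ω (j+3) = (xm,H)`, i.e. `j = i₀ − 3`). [cite: MadrasSlade1993, §3.2 (proof of Theorem 3.2.3)] -/
theorem spliceX_signature_fwd (hP : SpliceAddOK n 2 2 ω j (tpath offX 4 xm H true)) (hv : ω (j + 3) = pt xm H) :
    spliceAdd 2 2 ω (tpath offX 4 xm H true) j (j + 3) = pt (xm - 1) (H + 1) ∧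
    spliceAdd 2 2 ω (tpath offX 4 xm H true) j (j + 4) = pt (xm - 1) H ∧
    spliceAdd 2 2 ω (tpath offX 4 xm H true) j (j + 5) = pt xm H := by
  refine ⟨?_, ?_, ?_⟩
  · rw [spliceAdd_mid hP.start (by norm_num)]; simp [tpath, rd, offX]; ring_nf
  · rw [spliceAdd_mid hP.start (by norm_num)]; simp [tpath, rd, offX]; ring_nf
  · rw [spliceAdd_of_ge hP.finish (by omega), show j + 5 - 2 = j + 3 by omega, hv]

/-- **Signature of a case-X image, backward** (`j = i₀ + 1`, `ω (j−1) = (xm,H)`): the old corner `(xm,H)` at time `j−1`, then LEFT to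
`(xm−1,H)` at `j`, then UP to the corner `(xm−1,H+1)` at `j+1`. [cite: MadrasSlade1993, §3.2 (proof of Theorem 3.2.3)] -/
theorem spliceX_signature_bwd (hP : SpliceAddOK n 2 2 ω j (tpath offX 4 xm H false)) (hj : 1 ≤ j) (hv : ω (j - 1) = pt xm H) :
    spliceAdd 2 2 ω (tpath offX 4 xm H false) j (j - 1) = pt xm H ∧
    spliceAdd 2 2 ω (tpath offX 4 xm H false) j j = pt (xm - 1) H ∧
    spliceAdd 2 2 ω (tpath offX 4 xm H false) j (j + 1) = pt (xm - 1) (H + 1) := by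
  refine ⟨?_, ?_, ?_⟩
  · rw [spliceAdd_of_le (by omega), hv]
  · have := spliceAdd_mid (K := 2) (L := 2) (ω := ω) (j := j) hP.start (s := 0) (by norm_num)
    rw [add_zero] at this; rw [this]; simp [tpath, rd, offX]; ring_nf
  · rw [spliceAdd_mid hP.start (by norm_num)]; simp [tpath, rd, offX]; ring_nf

/-- **Signature of a case-Y image, forward** (`j = i₀`): corner `(xm+2,H)` at time `j+2`, then DOWN to `(xm+2,H−1)` at `j+3`, then
LEFT to `(xm+1,H−1)` at `j+4` — the opposite turn from case X, which is what separates the two image classes.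
[cite: MadrasSlade1993, §3.2 (proof of Theorem 3.2.3)] -/
theorem spliceY_signature_fwd (hP : SpliceAddOK n 2 2 ω j (tpath offY 4 xm H true)) :
    spliceAdd 2 2 ω (tpath offY 4 xm H true) j (j + 2) = pt (xm + 2) H ∧
    spliceAdd 2 2 ω (tpath offY 4 xm H true) j (j + 3) = pt (xm + 2) (H - 1) ∧
    spliceAdd 2 2 ω (tpath offY 4 xm H true) j (j + 4) = pt (xm + 1) (H - 1) := by
  refine ⟨?_, ?_, ?_⟩ <;> (rw [spliceAdd_mid hP.start (by norm_num)]; simp [tpath, rd, offY]) <;> ring_nf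

/-- **Signature of a case-Y image, backward** (`j = i₀ − 2`): `(xm+1,H−1)` at time `j`, RIGHT to `(xm+2,H−1)` at `j+1`, UP to the
corner `(xm+2,H)` at `j+2`. [cite: MadrasSlade1993, §3.2 (proof of Theorem 3.2.3)] -/
theorem spliceY_signature_bwd (hP : SpliceAddOK n 2 2 ω j (tpath offY 4 xm H false)) :
    spliceAdd 2 2 ω (tpath offY 4 xm H false) j (j + 2) = pt (xm + 2) H ∧
    spliceAdd 2 2 ω (tpath offY 4 xm H false) j (j + 1) = pt (xm + 2) (H - 1) ∧
    spliceAdd 2 2 ω (tpath offY 4 xm H false) j j = pt (xm + 1) (H - 1) := by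
  refine ⟨?_, ?_, ?_⟩
  · rw [spliceAdd_mid hP.start (by norm_num)]; simp [tpath, rd, offY]
  · rw [spliceAdd_mid hP.start (by norm_num)]; simp [tpath, rd, offY]; ring_nf
  · have := spliceAdd_mid (K := 2) (L := 2) (ω := ω) (j := j) hP.start (s := 0) (by norm_num)
    rw [add_zero] at this; rw [this]; simp [tpath, rd, offY]; ring_nf

/-- **Decoding within case X**: two canonical polygons with case-X surgeries (any corners, any orientations, any window positions
consistent with the corner in the forward orientation, `ω (j+3) = (xm,H)`) whose images coincide are EQUAL.  The image's
intrinsic top corner pins `(xm, H)` and the corner time; the site after the corner time pins the orientation (DOWN-then-RIGHT forward,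
the new path backward); then the window position is pinned and `eq_of_spliceAdd_eq` reads `ω` off. [cite: MadrasSlade1993, §3.2
(proof of Theorem 3.2.3: "Q can be unambiguously determined")] -/
theorem spliceX_decode {ω₁ ω₂ : ℕ → Site 2} {xm₁ H₁ xm₂ H₂ : ℤ} {j₁ j₂ : ℕ} {fwd₁ fwd₂ : Bool}
    (hω₁ : ω₁ ∈ canonEnd n) (hω₂ : ω₂ ∈ canonEnd n)
    (hmaxH₁ : ∀ i, i ≤ n → ω₁ i 1 ≤ H₁) (hmaxX₁ : ∀ i, i ≤ n → ω₁ i 1 = H₁ → ω₁ i 0 ≤ xm₁)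
    (hmaxH₂ : ∀ i, i ≤ n → ω₂ i 1 ≤ H₂) (hmaxX₂ : ∀ i, i ≤ n → ω₂ i 1 = H₂ → ω₂ i 0 ≤ xm₂)
    (hP₁ : SpliceAddOK n 2 2 ω₁ j₁ (tpath offX 4 xm₁ H₁ fwd₁)) (hP₂ : SpliceAddOK n 2 2 ω₂ j₂ (tpath offX 4 xm₂ H₂ fwd₂))
    (hw₁ : ∀ s, s ≤ 2 → ω₁ (j₁ + s) = tpath w6A 2 xm₁ H₁ fwd₁ s) (hw₂ : ∀ s, s ≤ 2 → ω₂ (j₂ + s) = tpath w6A 2 xm₂ H₂ fwd₂ s)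
    (hvf₁ : fwd₁ = true → ω₁ (j₁ + 3) = pt xm₁ H₁) (hvf₂ : fwd₂ = true → ω₂ (j₂ + 3) = pt xm₂ H₂)
    (h : spliceAdd 2 2 ω₁ (tpath offX 4 xm₁ H₁ fwd₁) j₁ = spliceAdd 2 2 ω₂ (tpath offX 4 xm₂ H₂ fwd₂) j₂) : ω₁ = ω₂ := by
  obtain ⟨hE₁, -⟩ := mem_canonEnd.1 hω₁
  obtain ⟨hE₂, -⟩ := mem_canonEnd.1 hω₂
  have hW : spliceAdd 2 2 ω₁ (tpath offX 4 xm₁ H₁ fwd₁) j₁ ∈ endAt (n + 2) (Pi.single 0 1 : Site 2) := spliceAdd_mem hE₁ hP₁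
  have hinj := (mem_endAt_iff.1 hW).1.2.2.2
  have T₁ := topAt_spliceX hmaxH₁ hmaxX₁ hP₁
  have T₂ := topAt_spliceX hmaxH₂ hmaxX₂ hP₂
  rw [← h] at T₂
  obtain ⟨eH, ex, eτ⟩ := topAt_unique hinj T₁ T₂
  have eH' : H₁ = H₂ := by omega
  have ex' : xm₁ = xm₂ := by omega
  subst eH' ex'
  -- orientation and window position from the site after the corner time
  cases fwd₁ <;> cases fwd₂ <;> simp only [rd, Bool.false_eq_true, ↓reduceIte] at eτ
  · -- both backward: `j₁ + 1 = j₂ + 1`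
    have ej : j₁ = j₂ := by omega
    subst ej
    exact eq_of_spliceAdd_eq hE₁ hE₂ hP₁ hP₂ hw₁ hw₂ h
  · -- ω₁ backward (corner at j₁+1), ω₂ forward (corner at j₂+3): compare the site at time corner+1
    exfalso
    -- for ω₁ the site at time j₁ + 2 is the new-path site `offX 2 = (xm−2, H+1)`; for ω₂ it is `(xm−1, H)`
    have e1 : spliceAdd 2 2 ω₁ (tpath offX 4 xm₁ H₁ false) j₁ (j₁ + 2) = pt (xm₁ - 2) (H₁ + 1) := by
      rw [spliceAdd_mid hP₁.start (by norm_num)]; simp [tpath, rd, offX]; ring_nf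
    rw [h, show j₁ + 2 = j₂ + 4 by omega] at e1
    obtain ⟨-, h4, -⟩ := spliceX_signature_fwd hP₂ (hvf₂ rfl)
    rw [h4] at e1; have := (pt_inj.1 e1).2; omega
  · exfalso
    have e1 : spliceAdd 2 2 ω₂ (tpath offX 4 xm₁ H₁ false) j₂ (j₂ + 2) = pt (xm₁ - 2) (H₁ + 1) := by
      rw [spliceAdd_mid hP₂.start (by norm_num)]; simp [tpath, rd, offX]; ring_nf
    rw [← h, show j₂ + 2 = j₁ + 4 by omega] at e1
    obtain ⟨-, h4, -⟩ := spliceX_signature_fwd hP₁ (hvf₁ rfl)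
    rw [h4] at e1; have := (pt_inj.1 e1).2; omega
  · -- both forward: `j₁ + 3 = j₂ + 3`
    have ej : j₁ = j₂ := by omega
    subst ej
    exact eq_of_spliceAdd_eq hE₁ hE₂ hP₁ hP₂ hw₁ hw₂ h

/-- **Decoding within case Y**: two canonical polygons with case-Y surgeries whose images coincide are equal (the corner `(xm+2, H)`
sits at time `j+2` in BOTH orientations, so the window position is pinned at once; the orientation is the site at time `j+3`:
`(xm+2, H−1)` forward, `(xm+1, H)` backward). [cite: MadrasSlade1993, §3.2 (proof of Theorem 3.2.3: "Q can be unambiguously determined")] -/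
theorem spliceY_decode {ω₁ ω₂ : ℕ → Site 2} {xm₁ H₁ xm₂ H₂ : ℤ} {j₁ j₂ : ℕ} {fwd₁ fwd₂ : Bool}
    (hω₁ : ω₁ ∈ canonEnd n) (hω₂ : ω₂ ∈ canonEnd n)
    (hmaxH₁ : ∀ i, i ≤ n → ω₁ i 1 ≤ H₁) (hmaxX₁ : ∀ i, i ≤ n → ω₁ i 1 = H₁ → ω₁ i 0 ≤ xm₁)
    (hmaxH₂ : ∀ i, i ≤ n → ω₂ i 1 ≤ H₂) (hmaxX₂ : ∀ i, i ≤ n → ω₂ i 1 = H₂ → ω₂ i 0 ≤ xm₂)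
    (hP₁ : SpliceAddOK n 2 2 ω₁ j₁ (tpath offY 4 xm₁ H₁ fwd₁)) (hP₂ : SpliceAddOK n 2 2 ω₂ j₂ (tpath offY 4 xm₂ H₂ fwd₂))
    (hw₁ : ∀ s, s ≤ 2 → ω₁ (j₁ + s) = tpath w2Y 2 xm₁ H₁ fwd₁ s) (hw₂ : ∀ s, s ≤ 2 → ω₂ (j₂ + s) = tpath w2Y 2 xm₂ H₂ fwd₂ s)
    (h : spliceAdd 2 2 ω₁ (tpath offY 4 xm₁ H₁ fwd₁) j₁ = spliceAdd 2 2 ω₂ (tpath offY 4 xm₂ H₂ fwd₂) j₂) : ω₁ = ω₂ := by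
  obtain ⟨hE₁, -⟩ := mem_canonEnd.1 hω₁
  obtain ⟨hE₂, -⟩ := mem_canonEnd.1 hω₂
  have hW : spliceAdd 2 2 ω₁ (tpath offY 4 xm₁ H₁ fwd₁) j₁ ∈ endAt (n + 2) (Pi.single 0 1 : Site 2) := spliceAdd_mem hE₁ hP₁
  have hinj := (mem_endAt_iff.1 hW).1.2.2.2
  have T₁ := topAt_spliceY hmaxH₁ hmaxX₁ hP₁
  have T₂ := topAt_spliceY hmaxH₂ hmaxX₂ hP₂
  rw [← h] at T₂
  obtain ⟨eH, ex, eτ⟩ := topAt_unique hinj T₁ T₂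
  have eH' : H₁ = H₂ := by omega
  have ex' : xm₁ = xm₂ := by omega
  subst eH' ex'
  have ej : j₁ = j₂ := by
    revert eτ; cases fwd₁ <;> cases fwd₂ <;> simp [rd]
  subst ej
  -- orientation from the site at time `j₁ + 3`
  have e3 : ∀ (f : Bool) (ω' : ℕ → Site 2), SpliceAddOK n 2 2 ω' j₁ (tpath offY 4 xm₁ H₁ f) →
      spliceAdd 2 2 ω' (tpath offY 4 xm₁ H₁ f) j₁ (j₁ + 3) =
        (if f then pt (xm₁ + 2) (H₁ - 1) else pt (xm₁ + 1) H₁) := by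
    intro f ω' hP'
    rw [spliceAdd_mid hP'.start (by norm_num)]
    cases f <;> simp [tpath, rd, offY]
    ring_nf
  have e31 := e3 fwd₁ ω₁ hP₁
  have e32 := e3 fwd₂ ω₂ hP₂
  rw [h] at e31
  rw [e31] at e32
  have ef : fwd₁ = fwd₂ := by
    revert e32; cases fwd₁ <;> cases fwd₂ <;> simp <;> intro h' <;> have := (pt_inj.1 h').2 <;> omega
  subst ef
  exact eq_of_spliceAdd_eq hE₁ hE₂ hP₁ hP₂ hw₁ hw₂ h

/-- **Case-X images and case-Y images are disjoint** (the door note's turn test, made exact): if a case-X image (corner data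
`xm₁, H₁`, orientation `fwd₁`, with `ω₁ (j₁+3) = (xm₁,H₁)` forward / `ω₁ (j₁−1) = (xm₁,H₁)` backward) equals a case-Y image, we
reach a contradiction by comparing the sites next to the common intrinsic top corner. [cite: MadrasSlade1993, §3.2 (proof of Theorem 3.2.3)] -/
theorem spliceX_ne_spliceY {ω₁ ω₂ : ℕ → Site 2} {xm₁ H₁ xm₂ H₂ : ℤ} {j₁ j₂ : ℕ} {fwd₁ fwd₂ : Bool}
    (hω₁ : ω₁ ∈ canonEnd n)
    (hmaxH₁ : ∀ i, i ≤ n → ω₁ i 1 ≤ H₁) (hmaxX₁ : ∀ i, i ≤ n → ω₁ i 1 = H₁ → ω₁ i 0 ≤ xm₁)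
    (hmaxH₂ : ∀ i, i ≤ n → ω₂ i 1 ≤ H₂) (hmaxX₂ : ∀ i, i ≤ n → ω₂ i 1 = H₂ → ω₂ i 0 ≤ xm₂)
    (hP₁ : SpliceAddOK n 2 2 ω₁ j₁ (tpath offX 4 xm₁ H₁ fwd₁)) (hP₂ : SpliceAddOK n 2 2 ω₂ j₂ (tpath offY 4 xm₂ H₂ fwd₂))
    (hvf₁ : fwd₁ = true → ω₁ (j₁ + 3) = pt xm₁ H₁) (hvb₁ : fwd₁ = false → 1 ≤ j₁ ∧ ω₁ (j₁ - 1) = pt xm₁ H₁)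
    (h : spliceAdd 2 2 ω₁ (tpath offX 4 xm₁ H₁ fwd₁) j₁ = spliceAdd 2 2 ω₂ (tpath offY 4 xm₂ H₂ fwd₂) j₂) : False := by
  obtain ⟨hE₁, -⟩ := mem_canonEnd.1 hω₁
  have hW : spliceAdd 2 2 ω₁ (tpath offX 4 xm₁ H₁ fwd₁) j₁ ∈ endAt (n + 2) (Pi.single 0 1 : Site 2) := spliceAdd_mem hE₁ hP₁
  have hinj := (mem_endAt_iff.1 hW).1.2.2.2
  have T₁ := topAt_spliceX hmaxH₁ hmaxX₁ hP₁
  have T₂ := topAt_spliceY hmaxH₂ hmaxX₂ hP₂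
  rw [← h] at T₂
  obtain ⟨eH, ex, eτ⟩ := topAt_unique hinj T₁ T₂
  -- sites of the two images near the corner, as functions of the orientation
  have X2 : spliceAdd 2 2 ω₁ (tpath offX 4 xm₁ H₁ fwd₁) j₁ (j₁ + 2) = pt (xm₁ - 2) (H₁ + 1) := by
    rw [spliceAdd_mid hP₁.start (by norm_num)]; cases fwd₁ <;> simp [tpath, rd, offX] <;> ring_nf
  have Y3 : spliceAdd 2 2 ω₂ (tpath offY 4 xm₂ H₂ fwd₂) j₂ (j₂ + 3) =
      (if fwd₂ then pt (xm₂ + 2) (H₂ - 1) else pt (xm₂ + 1) H₂) := by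
    rw [spliceAdd_mid hP₂.start (by norm_num)]; cases fwd₂ <;> simp [tpath, rd, offY]; ring_nf
  have Y4 : spliceAdd 2 2 ω₂ (tpath offY 4 xm₂ H₂ fwd₂) j₂ (j₂ + 4) =
      (if fwd₂ then pt (xm₂ + 1) (H₂ - 1) else pt xm₂ H₂) := by
    rw [spliceAdd_mid hP₂.start (by norm_num)]; cases fwd₂ <;> simp [tpath, rd, offY]; ring_nf
  have Y0 : spliceAdd 2 2 ω₂ (tpath offY 4 xm₂ H₂ fwd₂) j₂ j₂ =
      (if fwd₂ then pt xm₂ H₂ else pt (xm₂ + 1) (H₂ - 1)) := by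
    have := spliceAdd_mid (K := 2) (L := 2) (ω := ω₂) (j := j₂) hP₂.start (s := 0) (by norm_num)
    rw [add_zero] at this; rw [this]; cases fwd₂ <;> simp [tpath, rd, offY]; ring_nf
  cases fwd₁ <;> cases fwd₂ <;>
    simp only [rd, Bool.false_eq_true, ↓reduceIte] at eτ Y3 Y4 Y0
  · -- X backward (corner at j₁+1), Y backward (corner at j₂+2): compare time corner − 2
    obtain ⟨hj₁, hv⟩ := hvb₁ rfl
    have e : spliceAdd 2 2 ω₁ (tpath offX 4 xm₁ H₁ false) j₁ (j₁ - 1) = pt xm₁ H₁ := by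
      rw [spliceAdd_of_le (by omega), hv]
    rw [h, show j₁ - 1 = j₂ by omega, Y0] at e
    have := (pt_inj.1 e).1; have := (pt_inj.1 e).2; omega
  · -- X backward, Y forward: compare time corner + 1
    rw [h, show j₁ + 2 = j₂ + 3 by omega, Y3] at X2
    have := (pt_inj.1 X2).2; omega
  · -- X forward (corner at j₁+3), Y backward: compare time corner + 1
    obtain ⟨-, h4, -⟩ := spliceX_signature_fwd hP₁ (hvf₁ rfl)
    rw [h, show j₁ + 4 = j₂ + 3 by omega, Y3] at h4
    have := (pt_inj.1 h4).2; omega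
  · -- both forward: compare time corner + 2
    obtain ⟨-, -, h5⟩ := spliceX_signature_fwd hP₁ (hvf₁ rfl)
    rw [h, show j₁ + 5 = j₂ + 4 by omega, Y4] at h5
    have := (pt_inj.1 h5).1; omega

end StepTwoX

/-! ### The main classes and the injection they already carry (a-p4 g18)

`IsStepTwoMain n ω`: at the top corner of `ω` one of the classes X / Y1a (forward) / Y1a (backward) occurs; `IsStepTwoResidue n ω`:
the residue configuration of `stepTwo_classify`.  Every canonical rooted polygon with `n ≥ 5` is main or residue
(`isStepTwoMain_or_isStepTwoResidue`), and on the main class the `+2` surgeries above are a well-defined INJECTION into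
`canonEnd (n+2)` (`card_filter_isStepTwoMain_le`): the choice of surgery is free (any admissible case-X or case-Y datum), because the
decoding lemmas identify the source from the image whatever datum produced it. -/

section Main

/-- **Main classes X ∪ Y1a of the step-two line**: some top-corner datum `(H, xm, i₀)` of `ω` (extremal row `H`, extremal abscissa
`xm` on it, attained at time `i₀`, `xm ≥ 2`) with EITHER `(xm−3, H)` on `ω` (class X) OR the down–right–down pattern after / before the
corner (class Y1a, forward / backward). [cite: MadrasSlade1993, §3.2 (proof of Theorem 3.2.3: surgery at the lexicographically largest point)] -/
def IsStepTwoMain (n : ℕ) (ω : ℕ → Site 2) : Prop :=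
  ∃ (H xm : ℤ) (i₀ : ℕ), i₀ + 1 ≤ n ∧ ω i₀ = pt xm H ∧ 2 ≤ xm ∧
    (∀ i, i ≤ n → ω i 1 ≤ H) ∧ (∀ i, i ≤ n → ω i 1 = H → ω i 0 ≤ xm) ∧
    ((∃ t, t ≤ n ∧ ω t = pt (xm - 3) H) ∨
      (i₀ + 3 ≤ n ∧ ω (i₀ + 1) = pt xm (H - 1) ∧ ω (i₀ + 2) = pt (xm + 1) (H - 1) ∧ ω (i₀ + 3) = pt (xm + 1) (H - 2)) ∨
      (3 ≤ i₀ ∧ ω (i₀ - 1) = pt xm (H - 1) ∧ ω (i₀ - 2) = pt (xm + 1) (H - 1) ∧ ω (i₀ - 3) = pt (xm + 1) (H - 2)))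

/-- **Residue of the step-two line**: a top-corner datum with `(xm−3, H)` OFF `ω` and, below the corner, a step LEFT (Y2) or two steps
RIGHT (Y1b), in the orientation in which the corner is entered from the left. [cite: MadrasSlade1993, §3.2 (proof of Theorem 3.2.3)] -/
def IsStepTwoResidue (n : ℕ) (ω : ℕ → Site 2) : Prop :=
  ∃ (H xm : ℤ) (i₀ : ℕ), i₀ + 1 ≤ n ∧ ω i₀ = pt xm H ∧ 2 ≤ xm ∧
    (∀ i, i ≤ n → ω i 1 ≤ H) ∧ (∀ i, i ≤ n → ω i 1 = H → ω i 0 ≤ xm) ∧ (∀ t, t ≤ n → ω t ≠ pt (xm - 3) H) ∧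
    ((i₀ + 2 ≤ n ∧ ω (i₀ + 1) = pt xm (H - 1) ∧
        (ω (i₀ + 2) = pt (xm - 1) (H - 1) ∨ (i₀ + 3 ≤ n ∧ ω (i₀ + 2) = pt (xm + 1) (H - 1) ∧ ω (i₀ + 3) = pt (xm + 2) (H - 1)))) ∨
      (2 ≤ i₀ ∧ ω (i₀ - 1) = pt xm (H - 1) ∧
        (ω (i₀ - 2) = pt (xm - 1) (H - 1) ∨ (3 ≤ i₀ ∧ ω (i₀ - 2) = pt (xm + 1) (H - 1) ∧ ω (i₀ - 3) = pt (xm + 2) (H - 1)))))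

/-- **Dichotomy**: every canonical rooted polygon with `n ≥ 5` is in the main class or in the residue (repackaging of
`stepTwo_classify`). [cite: MadrasSlade1993, §3.2 (proof of Theorem 3.2.3)] -/
theorem isStepTwoMain_or_isStepTwoResidue (hω : ω ∈ canonEnd n) (hn : 5 ≤ n) :
    IsStepTwoMain n ω ∨ IsStepTwoResidue n ω := by
  obtain ⟨H, xm, i₀, fwd, hi₀, hi₀n, hv, hx2, hH1, hmaxH, hmaxX, hcase⟩ := stepTwo_classify hω hn
  rcases hcase with hX | ⟨-, h3n, h1, h2, h3⟩ | ⟨-, h3, h1, h2, h3'⟩ | ⟨hX, hres⟩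
  · exact Or.inl ⟨H, xm, i₀, hi₀n, hv, hx2, hmaxH, hmaxX, Or.inl hX⟩
  · exact Or.inl ⟨H, xm, i₀, hi₀n, hv, hx2, hmaxH, hmaxX, Or.inr (Or.inl ⟨h3n, h1, h2, h3⟩)⟩
  · exact Or.inl ⟨H, xm, i₀, hi₀n, hv, hx2, hmaxH, hmaxX, Or.inr (Or.inr ⟨h3, h1, h2, h3'⟩)⟩
  · refine Or.inr ⟨H, xm, i₀, hi₀n, hv, hx2, hmaxH, hmaxX, hX, ?_⟩
    rcases hres with ⟨-, h2n, h1, h23⟩ | ⟨-, h2, h1, h23⟩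
    · exact Or.inl ⟨h2n, h1, h23⟩
    · exact Or.inr ⟨h2, h1, h23⟩

/-- **Case X datum**: in class X the top surgery comes with its full decoding datum — an admissible window position `j` and an
orientation `fwd` such that the window reads `(xm−3,H)(xm−2,H)(xm−1,H)` and the old corner sits right after (forward) / before
(backward) the window. [cite: MadrasSlade1993, §3.2 (proof of Theorem 3.2.3)] -/
theorem stepTwo_data_X (hω : ω ∈ canonEnd n) (hn : 5 ≤ n) {H xm : ℤ}
    (hmaxH : ∀ i, i ≤ n → ω i 1 ≤ H) (hmaxX : ∀ i, i ≤ n → ω i 1 = H → ω i 0 ≤ xm)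
    (hv : ∃ i, i ≤ n ∧ ω i = pt xm H) (hX : ∃ t, t ≤ n ∧ ω t = pt (xm - 3) H) :
    ∃ (j : ℕ) (fwd : Bool), SpliceAddOK n 2 2 ω j (tpath offX 4 xm H fwd) ∧
      (∀ s, s ≤ 2 → ω (j + s) = tpath w6A 2 xm H fwd s) ∧
      (fwd = true → ω (j + 3) = pt xm H) ∧ (fwd = false → 1 ≤ j ∧ ω (j - 1) = pt xm H) := by
  obtain ⟨hE, hlex⟩ := mem_canonEnd.1 hω
  obtain ⟨⟨h0, -, hbw, hinj⟩, hn'⟩ := mem_endAt_iff.1 hE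
  have hcol := col_nonneg_of_mem_canonEnd hω
  obtain ⟨H', xm', i₀, hi₀, hi₀n, hv', hH1, hmaxH', hmaxX', hdir⟩ := exists_top_corner hω (by omega)
  -- the two corners coincide
  obtain ⟨i₁, hi₁, hv₁⟩ := hv
  have hHH : H' = H := by
    have b := hmaxH' i₁ hi₁; have c := hmaxH i₀ (by omega)
    rw [hv₁] at b; rw [hv'] at c; simp only [pt_apply_one] at b c; omega
  subst hHH
  have hxx : xm' = xm := by
    have a := hmaxX i₁ hi₁ (by rw [hv₁]; simp); have b := hmaxX' i₀ (by omega) (by rw [hv']; simp)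
    have c := hmaxX' i₁ hi₁ (by rw [hv₁]; simp); have d := hmaxX i₀ (by omega) (by rw [hv']; simp)
    rw [hv₁] at a c; rw [hv'] at b d; simp only [pt_apply_zero] at a b c d; omega
  subst hxx
  obtain ⟨t, ht, hωt⟩ := hX
  have hx3 : 3 ≤ xm' := by have := hcol t; rw [hωt] at this; simp only [pt_apply_zero] at this; omega
  rcases hdir with ⟨hp, hs⟩ | ⟨hs', hp'⟩
  · have hpar : (xm' + H') % 2 = 1 := by
      have hvc := vertical_cases (hbw i₀ (by omega)) (by rw [hv', hs]; simp)
      rw [hv', hs] at hvc; simp only [pt_apply_zero, pt_apply_one] at hvc; omega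
    obtain ⟨hi₀2, h2⟩ := top_corner_pred hω hi₀ hi₀n hv' hmaxH' hp hs
    obtain ⟨hi₀3, h3⟩ := caseA_fwd hE hpar hH1 hmaxH' hi₀2 hi₀n h2 hp ht hωt
    have hw : ∀ s, s ≤ 2 → ω (i₀ - 3 + s) = tpath w6A 2 xm' H' true s := by
      intro s hsL
      interval_cases s
      · exact tpath_eq (by rw [show i₀ - 3 + 0 = i₀ - 3 by omega, h3]) (by simp [rd, w6A])
      · exact tpath_eq (by rw [show i₀ - 3 + 1 = i₀ - 2 by omega, h2]) (by simp [rd, w6A])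
      · exact tpath_eq (by rw [show i₀ - 3 + 2 = i₀ - 1 by omega, hp]) (by simp [rd, w6A])
    exact ⟨i₀ - 3, true, spliceOK_X hpar hx3 (by omega) hmaxH' hmaxX' hw (by omega), hw,
      fun _ => by rw [show i₀ - 3 + 3 = i₀ by omega, hv'], fun h => absurd h (by decide)⟩
  · have hpar : (xm' + H') % 2 = 1 := by
      have hvc := vertical_cases (hbw (i₀ - 1) (by omega)) (by rw [show i₀ - 1 + 1 = i₀ by omega, hv', hp']; simp)
      rw [show i₀ - 1 + 1 = i₀ by omega, hv', hp'] at hvc; simp only [pt_apply_zero, pt_apply_one] at hvc; omega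
    obtain ⟨hi₀2, h2⟩ := top_corner_succ hω hi₀ hi₀n hv' hmaxH' hs' hp'
    obtain ⟨hi₀3, h3⟩ := caseA_bwd hE hpar hH1 hmaxH' hi₀2 h2 hs' ht hωt
    have hw : ∀ s, s ≤ 2 → ω (i₀ + 1 + s) = tpath w6A 2 xm' H' false s := by
      intro s hsL
      interval_cases s
      · exact tpath_eq (by rw [add_zero, hs']) (by simp [rd, w6A])
      · exact tpath_eq (by rw [show i₀ + 1 + 1 = i₀ + 2 by omega, h2]) (by simp [rd, w6A])
      · exact tpath_eq (by rw [show i₀ + 1 + 2 = i₀ + 3 by omega, h3]) (by simp [rd, w6A])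
    exact ⟨i₀ + 1, false, spliceOK_X hpar hx3 (by omega) hmaxH' hmaxX' hw (by omega), hw,
      fun h => absurd h (by decide), fun _ => ⟨by omega, by rw [show i₀ + 1 - 1 = i₀ by omega, hv']⟩⟩

/-- **Case Y1a datum, forward.** [cite: MadrasSlade1993, §3.2 (proof of Theorem 3.2.3)] -/
theorem stepTwo_data_Y_fwd (hω : ω ∈ canonEnd n) {H xm : ℤ} {i₀ : ℕ} (hx : 1 ≤ xm) (hi₀n : i₀ + 3 ≤ n)
    (hmaxH : ∀ i, i ≤ n → ω i 1 ≤ H) (hmaxX : ∀ i, i ≤ n → ω i 1 = H → ω i 0 ≤ xm)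
    (hv : ω i₀ = pt xm H) (h1 : ω (i₀ + 1) = pt xm (H - 1)) (h2 : ω (i₀ + 2) = pt (xm + 1) (H - 1))
    (h3 : ω (i₀ + 3) = pt (xm + 1) (H - 2)) :
    SpliceAddOK n 2 2 ω i₀ (tpath offY 4 xm H true) ∧ (∀ s, s ≤ 2 → ω (i₀ + s) = tpath w2Y 2 xm H true s) := by
  obtain ⟨hE, -⟩ := mem_canonEnd.1 hω
  obtain ⟨⟨h0, -, hbw, hinj⟩, hn'⟩ := mem_endAt_iff.1 hE
  have hpar : (xm + H) % 2 = 1 := by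
    have hvc := vertical_cases (hbw i₀ (by omega)) (by rw [hv, h1]; simp)
    rw [hv, h1] at hvc; simp only [pt_apply_zero, pt_apply_one] at hvc; omega
  have hE' := caseY_free hE hpar hx hmaxH hmaxX (a := i₀ + 2) (by omega) (by omega) h2
    (Or.inl ⟨by rw [show i₀ + 2 - 1 = i₀ + 1 by omega, h1], by rw [show i₀ + 2 + 1 = i₀ + 3 by omega, h3]⟩)
  have hw : ∀ s, s ≤ 2 → ω (i₀ + s) = tpath w2Y 2 xm H true s := by
    intro s hsL
    interval_cases s
    · exact tpath_eq (by rw [add_zero, hv]) (by simp [rd, w2Y])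
    · exact tpath_eq (by rw [h1]) (by simp [rd, w2Y])
    · exact tpath_eq (by rw [h2]) (by simp [rd, w2Y])
  exact ⟨spliceOK_Y hpar hx hmaxH hmaxX hE' hw (by omega), hw⟩

/-- **Case Y1a datum, backward.** [cite: MadrasSlade1993, §3.2 (proof of Theorem 3.2.3)] -/
theorem stepTwo_data_Y_bwd (hω : ω ∈ canonEnd n) {H xm : ℤ} {i₀ : ℕ} (hx : 1 ≤ xm) (hi₀ : 3 ≤ i₀) (hi₀n : i₀ ≤ n)
    (hmaxH : ∀ i, i ≤ n → ω i 1 ≤ H) (hmaxX : ∀ i, i ≤ n → ω i 1 = H → ω i 0 ≤ xm)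
    (hv : ω i₀ = pt xm H) (h1 : ω (i₀ - 1) = pt xm (H - 1)) (h2 : ω (i₀ - 2) = pt (xm + 1) (H - 1))
    (h3 : ω (i₀ - 3) = pt (xm + 1) (H - 2)) :
    SpliceAddOK n 2 2 ω (i₀ - 2) (tpath offY 4 xm H false) ∧
      (∀ s, s ≤ 2 → ω (i₀ - 2 + s) = tpath w2Y 2 xm H false s) := by
  obtain ⟨hE, -⟩ := mem_canonEnd.1 hω
  obtain ⟨⟨h0, -, hbw, hinj⟩, hn'⟩ := mem_endAt_iff.1 hE
  have hpar : (xm + H) % 2 = 1 := by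
    have hvc := vertical_cases (hbw (i₀ - 1) (by omega)) (by rw [show i₀ - 1 + 1 = i₀ by omega, hv, h1]; simp)
    rw [show i₀ - 1 + 1 = i₀ by omega, hv, h1] at hvc; simp only [pt_apply_zero, pt_apply_one] at hvc; omega
  have hE' := caseY_free hE hpar hx hmaxH hmaxX (a := i₀ - 2) (by omega) (by omega) h2
    (Or.inr ⟨by rw [show i₀ - 2 + 1 = i₀ - 1 by omega, h1], by rw [show i₀ - 2 - 1 = i₀ - 3 by omega, h3]⟩)
  have hw : ∀ s, s ≤ 2 → ω (i₀ - 2 + s) = tpath w2Y 2 xm H false s := by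
    intro s hsL
    interval_cases s
    · exact tpath_eq (by rw [add_zero, h2]) (by simp [rd, w2Y])
    · exact tpath_eq (by rw [show i₀ - 2 + 1 = i₀ - 1 by omega, h1]) (by simp [rd, w2Y])
    · exact tpath_eq (by rw [show i₀ - 2 + 2 = i₀ by omega, hv]) (by simp [rd, w2Y])
  exact ⟨spliceOK_Y hpar hx hmaxH hmaxX hE' hw (by omega), hw⟩

/-- **An image with its decoding datum** for every polygon of the main class: a canonical `(n+3)`-gon `W` obtained from `ω` by a
case-X surgery (with window, orientation and old-corner facts) or by a case-Y surgery (with window facts), at a top-corner datum.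
[cite: MadrasSlade1993, §3.2 (proof of Theorem 3.2.3)] -/
theorem exists_stepTwoMain_image (hω : ω ∈ canonEnd n) (hn : 5 ≤ n) (hm : IsStepTwoMain n ω) :
    ∃ W : ℕ → Site 2, W ∈ canonEnd (n + 2) ∧ ∃ (H xm : ℤ) (j : ℕ) (fwd : Bool),
      (∀ i, i ≤ n → ω i 1 ≤ H) ∧ (∀ i, i ≤ n → ω i 1 = H → ω i 0 ≤ xm) ∧
      ((SpliceAddOK n 2 2 ω j (tpath offX 4 xm H fwd) ∧ (∀ s, s ≤ 2 → ω (j + s) = tpath w6A 2 xm H fwd s) ∧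
          (fwd = true → ω (j + 3) = pt xm H) ∧ (fwd = false → 1 ≤ j ∧ ω (j - 1) = pt xm H) ∧
          W = spliceAdd 2 2 ω (tpath offX 4 xm H fwd) j) ∨
        (SpliceAddOK n 2 2 ω j (tpath offY 4 xm H fwd) ∧ (∀ s, s ≤ 2 → ω (j + s) = tpath w2Y 2 xm H fwd s) ∧
          W = spliceAdd 2 2 ω (tpath offY 4 xm H fwd) j)) := by
  obtain ⟨H, xm, i₀, hi₀n, hv, hx2, hmaxH, hmaxX, hcase⟩ := hm
  rcases hcase with hX | ⟨h3n, h1, h2, h3⟩ | ⟨h3, h1, h2, h3'⟩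
  · obtain ⟨j, fwd, hP, hw, hvf, hvb⟩ := stepTwo_data_X hω hn hmaxH hmaxX ⟨i₀, by omega, hv⟩ hX
    exact ⟨_, spliceAdd_mem_canonEnd hω hP, H, xm, j, fwd, hmaxH, hmaxX, Or.inl ⟨hP, hw, hvf, hvb, rfl⟩⟩
  · obtain ⟨hP, hw⟩ := stepTwo_data_Y_fwd hω (by omega) h3n hmaxH hmaxX hv h1 h2 h3
    exact ⟨_, spliceAdd_mem_canonEnd hω hP, H, xm, i₀, true, hmaxH, hmaxX, Or.inr ⟨hP, hw, rfl⟩⟩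
  · obtain ⟨hP, hw⟩ := stepTwo_data_Y_bwd hω (by omega) h3 (by omega) hmaxH hmaxX hv h1 h2 h3'
    exact ⟨_, spliceAdd_mem_canonEnd hω hP, H, xm, i₀ - 2, false, hmaxH, hmaxX, Or.inr ⟨hP, hw, rfl⟩⟩

/-- **Decoding is datum-free**: two polygons of `canonEnd n` with images-with-datum (in the sense of
`exists_stepTwoMain_image`) that coincide are equal — X/X by `spliceX_decode`, Y/Y by `spliceY_decode`, X/Y impossible by
`spliceX_ne_spliceY`. [cite: MadrasSlade1993, §3.2 (proof of Theorem 3.2.3: "Q can be unambiguously determined")] -/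
theorem eq_of_stepTwoMain_image_eq {ω₁ ω₂ W : ℕ → Site 2} (hω₁ : ω₁ ∈ canonEnd n) (hω₂ : ω₂ ∈ canonEnd n)
    {H₁ xm₁ : ℤ} {j₁ : ℕ} {fwd₁ : Bool} {H₂ xm₂ : ℤ} {j₂ : ℕ} {fwd₂ : Bool}
    (hmaxH₁ : ∀ i, i ≤ n → ω₁ i 1 ≤ H₁) (hmaxX₁ : ∀ i, i ≤ n → ω₁ i 1 = H₁ → ω₁ i 0 ≤ xm₁)
    (hmaxH₂ : ∀ i, i ≤ n → ω₂ i 1 ≤ H₂) (hmaxX₂ : ∀ i, i ≤ n → ω₂ i 1 = H₂ → ω₂ i 0 ≤ xm₂)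
    (h₁ : (SpliceAddOK n 2 2 ω₁ j₁ (tpath offX 4 xm₁ H₁ fwd₁) ∧ (∀ s, s ≤ 2 → ω₁ (j₁ + s) = tpath w6A 2 xm₁ H₁ fwd₁ s) ∧
          (fwd₁ = true → ω₁ (j₁ + 3) = pt xm₁ H₁) ∧ (fwd₁ = false → 1 ≤ j₁ ∧ ω₁ (j₁ - 1) = pt xm₁ H₁) ∧
          W = spliceAdd 2 2 ω₁ (tpath offX 4 xm₁ H₁ fwd₁) j₁) ∨
        (SpliceAddOK n 2 2 ω₁ j₁ (tpath offY 4 xm₁ H₁ fwd₁) ∧ (∀ s, s ≤ 2 → ω₁ (j₁ + s) = tpath w2Y 2 xm₁ H₁ fwd₁ s) ∧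
          W = spliceAdd 2 2 ω₁ (tpath offY 4 xm₁ H₁ fwd₁) j₁))
    (h₂ : (SpliceAddOK n 2 2 ω₂ j₂ (tpath offX 4 xm₂ H₂ fwd₂) ∧ (∀ s, s ≤ 2 → ω₂ (j₂ + s) = tpath w6A 2 xm₂ H₂ fwd₂ s) ∧
          (fwd₂ = true → ω₂ (j₂ + 3) = pt xm₂ H₂) ∧ (fwd₂ = false → 1 ≤ j₂ ∧ ω₂ (j₂ - 1) = pt xm₂ H₂) ∧
          W = spliceAdd 2 2 ω₂ (tpath offX 4 xm₂ H₂ fwd₂) j₂) ∨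
        (SpliceAddOK n 2 2 ω₂ j₂ (tpath offY 4 xm₂ H₂ fwd₂) ∧ (∀ s, s ≤ 2 → ω₂ (j₂ + s) = tpath w2Y 2 xm₂ H₂ fwd₂ s) ∧
          W = spliceAdd 2 2 ω₂ (tpath offY 4 xm₂ H₂ fwd₂) j₂)) : ω₁ = ω₂ := by
  rcases h₁ with ⟨hP₁, hw₁, hvf₁, hvb₁, rfl⟩ | ⟨hP₁, hw₁, rfl⟩ <;> rcases h₂ with ⟨hP₂, hw₂, hvf₂, hvb₂, h⟩ | ⟨hP₂, hw₂, h⟩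
  · exact spliceX_decode hω₁ hω₂ hmaxH₁ hmaxX₁ hmaxH₂ hmaxX₂ hP₁ hP₂ hw₁ hw₂ hvf₁ hvf₂ h
  · exact (spliceX_ne_spliceY hω₁ hmaxH₁ hmaxX₁ hmaxH₂ hmaxX₂ hP₁ hP₂ hvf₁ hvb₁ h).elim
  · exact (spliceX_ne_spliceY hω₂ hmaxH₂ hmaxX₂ hmaxH₁ hmaxX₁ hP₂ hP₁ hvf₂ hvb₂ h.symm).elim
  · exact spliceY_decode hω₁ hω₂ hmaxH₁ hmaxX₁ hmaxH₂ hmaxX₂ hP₁ hP₂ hw₁ hw₂ h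

/-- **★ The step two holds on the main class**: the canonical rooted `(n+1)`-gons (`n ≥ 5`) of class X ∪ Y1a inject into the
canonical rooted `(n+3)`-gons, so their number is at most `#canonEnd (n+2) = q_{n+3}(ℍ)`.  (The residue class — numerically
about 30 % of `canonEnd n` for `13 ≤ n ≤ 25`, and containing the flip-free «Y» polygons — is what separates this from
`q_N ≤ q_{N+2}`; see the door notes.) [cite: MadrasSlade1993, §3.2, Theorem 3.2.3 / (3.2.3) (the `ℤ^d` statement being transplanted)] -/
theorem card_filter_isStepTwoMain_le [DecidablePred (IsStepTwoMain n)] (hn : 5 ≤ n) :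
    #((canonEnd n).filter (IsStepTwoMain n)) ≤ #(canonEnd (n + 2)) := by
  classical
  -- the (noncomputable) image map: a chosen image-with-datum on the main class, junk elsewhere
  let E : (ℕ → Site 2) → (ℕ → Site 2) := fun ω =>
    if h : ω ∈ canonEnd n ∧ IsStepTwoMain n ω then Classical.choose (exists_stepTwoMain_image h.1 hn h.2) else ω
  have hE : ∀ ω, ∀ h : ω ∈ canonEnd n ∧ IsStepTwoMain n ω,
      E ω = Classical.choose (exists_stepTwoMain_image h.1 hn h.2) := fun ω h => dif_pos h
  refine Finset.card_le_card_of_injOn E (fun ω hω => ?_) (fun ω₁ hω₁ ω₂ hω₂ heq => ?_)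
  · rw [Finset.mem_coe, Finset.mem_filter] at hω
    rw [Finset.mem_coe, hE ω hω]
    exact (Classical.choose_spec (exists_stepTwoMain_image hω.1 hn hω.2)).1
  · rw [Finset.mem_coe, Finset.mem_filter] at hω₁ hω₂
    rw [hE ω₁ hω₁, hE ω₂ hω₂] at heq
    obtain ⟨-, H₁, xm₁, j₁, fwd₁, hmaxH₁, hmaxX₁, h₁⟩ := Classical.choose_spec (exists_stepTwoMain_image hω₁.1 hn hω₁.2)
    obtain ⟨-, H₂, xm₂, j₂, fwd₂, hmaxH₂, hmaxX₂, h₂⟩ := Classical.choose_spec (exists_stepTwoMain_image hω₂.1 hn hω₂.2)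
    rw [heq] at h₁
    exact eq_of_stepTwoMain_image_eq hω₁.1 hω₂.1 hmaxH₁ hmaxX₁ hmaxH₂ hmaxX₂ h₁ h₂

/-- **Complement form**: `#canonEnd n − #(residue) ≤ #canonEnd (n+2)` — the step two `q_{n+1} ≤ q_{n+3}` would follow from an
injection of the residue into the images NOT used by the main class. [cite: MadrasSlade1993, §3.2, Theorem 3.2.3 / (3.2.3)] -/
theorem card_canonEnd_sub_card_filter_residue_le [DecidablePred (IsStepTwoMain n)] [DecidablePred (IsStepTwoResidue n)]
    (hn : 5 ≤ n) :
    #(canonEnd n) - #((canonEnd n).filter (IsStepTwoResidue n)) ≤ #(canonEnd (n + 2)) := by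
  classical
  have hcover : canonEnd n ⊆ (canonEnd n).filter (IsStepTwoMain n) ∪ (canonEnd n).filter (IsStepTwoResidue n) := by
    intro ω hω
    rcases isStepTwoMain_or_isStepTwoResidue hω hn with h | h
    · exact Finset.mem_union_left _ (Finset.mem_filter.2 ⟨hω, h⟩)
    · exact Finset.mem_union_right _ (Finset.mem_filter.2 ⟨hω, h⟩)
  have h1 := (Finset.card_le_card hcover).trans (Finset.card_union_le _ _)
  have h2 := card_filter_isStepTwoMain_le (n := n) hn
  omega

end Main

end PolygonConcat

end HexBW

end Literature.Probability.RandomPlanarGeometry.SAW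

end
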